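import Summits.FinalStateConjecture.FinalStateConjecture.Theorems.StarvedNecksNecksCertifyReductionZero
import Summits.FinalStateConjecture.FinalStateConjecture.Theorems.StarvedNecksGapDecaySufficesStubGapBootstrap
import Summits.FinalStateConjecture.FinalStateConjecture.Theorems.StarvedNecksGapDecaySufficesStubFlatFarCertified
import Summits.FinalStateConjecture.FinalStateConjecture.Theorems.StarvedNecksGapDecaySufficesStubClopenSurjection
import Summits.FinalStateConjecture.FinalStateConjecture.Theorems.StarvedNecksGapDecaySufficesStubCollarLateFlat
import Summits.FinalStateConjecture.FinalStateConjecture.Theorems.GapDecaySuffices.Negative.RelabelDecomposition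
import Literature.Geometry.Lorentzian.BackgroundChartCalculus
import Summits.FinalStateConjecture.FinalStateConjecture.Theorems.StarvedNecksGapDecaySufficesStubAnchoredEntry
import Summits.FinalStateConjecture.FinalStateConjecture.Theorems.StarvedNecksGapDecaySufficesStubAnchoredRays
import Summits.FinalStateConjecture.FinalStateConjecture.Theorems.StarvedNecksGapDecaySufficesStubQuantAlexandrovZeeman
import Summits.FinalStateConjecture.FinalStateConjecture.Theorems.StarvedNecksGapDecaySufficesStubAnchoredLocationV2
import Summits.FinalStateConjecture.FinalStateConjecture.Theorems.StarvedNecksGapDecaySufficesRelabelPullbackNorms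
import Summits.FinalStateConjecture.FinalStateConjecture.Theorems.StarvedNecksGapDecaySufficesRelabelReflection
import Summits.FinalStateConjecture.FinalStateConjecture.Theorems.StarvedNecksGapDecaySufficesRelabelEach
import Summits.FinalStateConjecture.FinalStateConjecture.Theorems.StarvedNecksGapDecaySufficesStubLabelMatchingConditional
import Summits.FinalStateConjecture.FinalStateConjecture.Theorems.StarvedNecksGapDecaySufficesStubChartSurgeryCore
import Summits.FinalStateConjecture.FinalStateConjecture.Theorems.StarvedNecksGapDecaySufficesStubSeamSurgeryPos
import Summits.FinalStateConjecture.FinalStateConjecture.Theorems.StarvedNecksGapDecaySufficesStubOneSidedIntervalComparison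
import Summits.FinalStateConjecture.FinalStateConjecture.Theorems.StarvedNecksGapDecaySufficesStubAssemblyConcaveDominator
import Summits.FinalStateConjecture.FinalStateConjecture.Theorems.StarvedNecksGapDecaySufficesStubAnchoredLocationP
import Summits.FinalStateConjecture.FinalStateConjecture.Theorems.StarvedNecksGapDecaySufficesStubSeededLocationMain
import Summits.FinalStateConjecture.FinalStateConjecture.Theorems.StarvedNecksGapDecaySufficesStubAssembly
import HarnessLib.Audit

/-!
# Line `Sketch` — crux `StarvedNecks.GapDecaySuffices` (stmt-FinalStateConjecture-18060)

Lead's skeleton (prover-line-stmt-FinalStateConjecture-18060-0, 2026-08-17).  The crux (FIXED, concluded BY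
NAME by `GapDecaySuffices_of`):
`Summit.FinalStateConjecture.FinalStateConjecture.Theses.StarvedNecks.GapDecaySuffices := NeckGapDecay → NecksCertifyR`.

## The line in one paragraph

`NecksCertifyR` is reached PER INPUT through the landed chain of the predecessor crux — cone separation
(`…Cones.stub_coneSeparation`, p106992), chart surgery (`…Bookkeeping.stub_chartSurgery`, p107332) and the
seam (`…Seam.stub_seamSurgery`, p94437, fed by the landed SCR p81554 / SFR p78126) — applied NOT to the
input `d` itself but to a RELABELLED honest input `d'` of the same exterior (`d'.charted = d.charted`):
relabelling is forced, because the v5 `NeckCertificate` pins the re-gauged hole chart to the input hole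
chart inside `R₁ + 1` (K6) and to the input flat chart far out (K7), which is impossible whenever the two
input charts induce OPPOSITE ORIENTATIONS on the exterior (an honest, parity-reflected flat chart `Φ ∘ P`
satisfies every hypothesis of the crux) — so the predecessor's universal reduction
`necksCertifyR_of_neckLedgerAnalysisPos` (p131681) is not usable as the last step, and the assembly must be
free to reflect / re-excise the labels first.  For `0 < d.N` the certificate of `d'` is built hole by hole
from (S1) the re-excision bootstrap of the gap certificate (walls `W ≥ 3ρ' + 2` for EVERY sublinear
majorant `ρ' ≥ ρᵢ` of the SAME input), (S2) the far certification of the input flat chart against the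
boosted Kerr background on hole slabs beyond `2ρ'` (flat `C⁴` certificate + Kerr tail), (S3) the INWARD
SWITCH-OFF of one near-isometry of `(E4, η)` with `C²` control and log-room `→ ∞` (the analytic core —
John-type mean-frame rigidity + in-group / Whitney blending; the filed s1/s3 "ODE rigidity + displacement
blend to a Poincaré map" is refuted at the stub level by the honest log-spiral vortex and boost-flash
gauges of the ideators' cards, `Ideas/{vortex-foam-switch-off, cone-pinched-rigidity-mollified-seam}`,
`NegativeNotes-honest-vortex-flash-gauges-r1k1.md`), (S4) ANCHORED LOCATION of the gap chart's collar in
the flat chart's image with coarse clock / radius control (card `curvature-anchored-location` /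
`neck-timeline-anchoring`), and (S5) the chart assembly `Ψₐ := Ψg ∘ S` inside `(5/4)σ`, `:= Φ` beyond,
`σ := (8/5)ρ'`, with the Causality-API bookkeeping K10–K13 of the v5 certificate for the relabelled input.

## Registered stubs — skeleton v9 (lead c1 = prover-line-stmt-FinalStateConjecture-18060-c1-0, 2026-08-17, end of cycle 1)

v7 = v6 + PARITY-SAFE INTERFACE (hinge `WeakCertificateAfterRelabelling`, Hf(2) only; composition through the LANDED `stub_chartSurgeryCore`
p164628 / `stub_seamSurgeryPos` p164565).  v8 = LM outputs `d'.N = d.N` and eventually non-negative excisions; S4 for non-degenerate windows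
(`AnchoredLocationP ⇐ SeededLocationP`, LANDED p166857); S4′ ⇐ X₁ `UniformLocation` ∧ X₂ `LateSeed` (LANDED p168266); S5 ⇐ A `PerHoleRegauge` ∧
B `CertificateBookkeeping` ∧ C `ConcaveDominator` (LANDED p168243, C LANDED p166564).  v9 = all headers filled with the landed decls.
OPEN registered stubs (6): `stub_switchOffInward` (S3, LEAD; deep regime open, F13 box threshold to come), `stub_labelMatching` (misstatement
boundary: Hf(4) = anchoring ∧ non-negative excision, + clock window per F11), `stub_uniformLocation` (X₁ ⇐ BandLocation ⇐ CoarsePoincareStability,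
wave-2 reduction in the lead folder), `stub_lateSeed` (X₂ ⇐ AnchoredClock ∧ NearZoneCovered, wave-2 reduction), `stub_perHoleRegauge`
(A ⇐ TransitionSwitchOff ∧ GluedChartSmooth, wave-2 reduction, most clauses proved), `stub_certificateBookkeeping` (B ⇐ GapTubesExclusive ∧
FlatInnerCofinal ∧ HoleSlabsCofinal ∧ RimEscape, wave-2 reduction, K10-outer/K12-covering/frontier proved).
LANDED bricks: S1 p137784, S2 p138385, p138641, p138651, p141093+p144407+p146030 (QAZ), p143739, p144058, p144389, p146134, p146145, p146672,
p146668, p164942 (OneSidedIntervalComparison), p167503 (Band), p167597 (Inputs), p167524 (AssemblyDefs).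

`GapDecaySuffices_of : S1 → S2 → S3 → S4 → LM → S5 → N1b′-core → N2-pos → GapDecaySuffices` is PROVED below
(pure logic over the landed chain).  Namespace `…Cruxes.GapDecaySuffices.Sketch`; registered signatures are the theorem headers
of `stub_*` (bundles by the names of the `def`s of this file, all of which are verbatim copies of the
landed `let`-bundles or are defined here).
-/

noncomputable section

open scoped Manifold ContDiff Topology ENNReal
open Filter Set MeasureTheory Topology Literature.Geometry.Lorentzian

namespace Summit.FinalStateConjecture.FinalStateConjecture.Cruxes.GapDecaySuffices.Sketch

set_option linter.dupNamespace false
set_option linter.unusedVariables false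

/-! ## The crux's let-bound bundles, named (verbatim copies of the landed chain's bundles) -/

/-- `HonestCore` = the crux's `Hc` (verbatim). -/
def HonestCore (𝓢 : Spacetime.{0} 4) (O : Set 𝓢.carrier) (k : ℕ) (d : FinalStateDecomposition 𝓢 O k)
    (R₀ : ℝ) : Prop :=
  let B := d.background; let t := fun i ↦ (B i).time; let r := fun i ↦ (B i).radius; let Ψ := d.chart;
  (∀ i, Kerr.IsSubextremal (d.mass i) (d.spin i) ∧ 100 * d.mass i ≤ R₀ ∧ 0 < ((d.motion i).1 : E4 ≃L[ℝ] E4) (E4.basisVector 0) 0) ∧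
    (∀ i (ϱ τ₂ : ℝ), R₀ ≤ ϱ → d.τ₀ < τ₂ → Ψ i '' {x | d.τ₀ < t i x.1 ∧ t i x.1 < τ₂ ∧ r i x.1 < ϱ} ⊆ 𝓢.metric.causalPast 𝓢.timeOrientation (Ψ i '' (B i).truncTimeSlab ϱ τ₂)) ∧
    (∀ i (τ' : ℝ) (ϱ : ℝ → ℝ), Continuous ϱ → d.τ₀ < τ' → let A := Ψ i '' {x | τ' ≤ t i x.1 ∧ r i x.1 ≤ ϱ (t i x.1)}; closure A ∩ O ⊆ A) ∧
    (∀ y : d.flatDomain, d.τ₀ < y.1 0 → 𝓢.timeOrientation.IsFutureDirected (mfderiv 𝓘(ℝ, E4) (𝓡 4) d.flatChart y (E4.basisVector 0)))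

/-- `HonestFar` = the crux's `Hf` (verbatim). -/
def HonestFar (𝓢 : Spacetime.{0} 4) (O : Set 𝓢.carrier) (k : ℕ) (d : FinalStateDecomposition 𝓢 O k)
    (R₀ : ℝ) : Prop :=
  let B := d.background; let t := fun i ↦ (B i).time; let r := fun i ↦ (B i).radius; let Φ := d.flatChart;
  (∀ τ₂ : ℝ, d.τ₀ < τ₂ → Φ '' {y | d.τ₀ < y.1 0 ∧ y.1 0 < τ₂} ⊆ 𝓢.metric.causalPast 𝓢.timeOrientation (Φ '' (Minkowski.backgroundOn d.flatDomain).timeSlab τ₂)) ∧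
    (∀ τ' : ℝ, d.τ₀ < τ' → closure (Φ '' {y | τ' ≤ y.1 0 ∧ ∀ i, d.excision i (y.1 0) + 1 ≤ r i y.1}) ⊆ Φ '' {y | τ' ≤ y.1 0}) ∧
    (∀ i, ∃ T : ℝ, supCkENorm (Subtype.val '' {x : (B i).domain | T ≤ t i x.1 ∧ R₀ ≤ r i x.1 ∧ ∀ j, j ≠ i → r i x.1 ≤ r j x.1}) 0 (𝓢.deviationExtend (B i) (d.chart i)) ≤ ENNReal.ofReal (1 / (10 * ‖(((d.motion i).1 : E4 ≃L[ℝ] E4) : E4 →L[ℝ] E4)‖ ^ 2)))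

/-- Pairwise distinct asymptotic four-velocities `Λᵢ e₀ ≠ Λⱼ e₀` (the crux's DV antecedent, verbatim). -/
def DistinctVelocities (𝓢 : Spacetime.{0} 4) (O : Set 𝓢.carrier) (k : ℕ)
    (d : FinalStateDecomposition 𝓢 O k) : Prop :=
  ∀ i j : Fin d.N, i ≠ j →
    ((d.motion i).1 : E4 ≃L[ℝ] E4) (E4.basisVector 0) ≠ ((d.motion j).1 : E4 ≃L[ℝ] E4) (E4.basisVector 0)

/-- `NeckCertificate` = K1–K13 of the v5 skeleton (verbatim the `let`-bundle of the landed
`…Bookkeeping.stub_chartSurgery` / `…ReductionZero.necksCertify_repaired_of_neckLedgerAnalysisPos`). -/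
def NeckCertificate (𝓢 : Spacetime.{0} 4) (O : Set 𝓢.carrier) (d : FinalStateDecomposition 𝓢 O 4)
    (R₀ : ℝ) : Prop :=
  let B := d.background; let t := fun i ↦ (B i).time; let r := fun i ↦ (B i).radius
  let Λ := fun i ↦ ((d.motion i).1 : E4 ≃L[ℝ] E4); let Φ := d.flatChart; let Ψ := d.chart
  let ρ := d.excision
  ∃ (R₁ τ₁ : ℝ) (ρa Rc : Fin d.N → ℝ → ℝ) (Ψa : ∀ i, (B i).domain → 𝓢.carrier),
    R₀ ≤ R₁ ∧ d.τ₀ ≤ τ₁ ∧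
    (∀ i, Monotone (ρa i) ∧ Continuous (ρa i) ∧ Tendsto (fun s ↦ ρa i s / s) atTop (𝓝 0) ∧
      Tendsto (ρa i) atTop atTop ∧ ∀ s, R₁ + 1 ≤ ρa i s ∧ (τ₁ ≤ s → ρ i s + 1 ≤ ρa i s)) ∧
    (∀ i, Monotone (Rc i) ∧ Continuous (Rc i) ∧ Tendsto (fun s ↦ Rc i s / s) atTop (𝓝 0) ∧
      Tendsto (Rc i) atTop atTop ∧ ∀ s, R₁ + 4 ≤ Rc i s) ∧
    (∀ j (y : E4), τ₁ ≤ y 0 → r j y ≤ 9 * ρa j (y 0) → r j y + 3 ≤ Rc j (t j y)) ∧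
    (∀ i, let U : Set (B i).domain := {x | τ₁ < t i x.1 ∧ r i x.1 < Rc i (t i x.1) + 2}
      ContMDiffOn 𝓘(ℝ, E4) (𝓡 4) ∞ (Ψa i) U ∧ IsOpenEmbedding (U.restrict (Ψa i)) ∧
        Ψa i '' U ⊆ d.charted) ∧
    (∀ i (x : (B i).domain), r i x.1 ≤ R₁ + 1 → Ψa i x = Ψ i x) ∧
    (∀ i (y : E4) (hy : y ∈ (B i).domain), τ₁ ≤ y 0 → 4 * ρa i (y 0) ≤ r i y →
      r i y ≤ Rc i (t i y) + 2 → ∃ hy' : y ∈ d.flatDomain, Ψa i ⟨y, hy⟩ = Φ ⟨y, hy'⟩) ∧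
    (∀ i, Tendsto (fun τ ↦ 𝓢.truncDeviationCk (B i) (Ψa i) 2 (Rc i τ) τ) atTop (𝓝 0)) ∧
    (∀ i, supCkENorm (Subtype.val '' {x : (B i).domain | τ₁ ≤ t i x.1 ∧ R₁ ≤ r i x.1 ∧
        r i x.1 ≤ Rc i (t i x.1) + 2}) 0 (𝓢.deviationExtend (B i) (Ψa i)) ≤
      ENNReal.ofReal (1 / (10 * ‖(Λ i : E4 →L[ℝ] E4)‖ ^ 2))) ∧
    (∀ i (x : (B i).domain), τ₁ ≤ t i x.1 → R₁ ≤ r i x.1 → r i x.1 ≤ Rc i (t i x.1) + 2 →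
      𝓢.timeOrientation.IsFutureDirected
        (mfderiv 𝓘(ℝ, E4) (𝓡 4) (Ψa i) x ((Λ i) (E4.basisVector 0)))) ∧
    (∀ i j, i ≠ j → Disjoint (Ψa i '' {x | τ₁ < t i x.1 ∧ r i x.1 < Rc i (t i x.1) + 2})
      (Ψa j '' {x | τ₁ < t j x.1 ∧ r j x.1 < Rc j (t j x.1) + 2})) ∧
    (∀ i (τ' : ℝ) (ϱ : ℝ → ℝ), Continuous ϱ → τ₁ < τ' → (∀ s, ϱ s < Rc i s + 2) →
      closure (Ψa i '' {x | τ' ≤ t i x.1 ∧ r i x.1 ≤ ϱ (t i x.1)}) ∩ O ⊆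
        Ψa i '' {x | τ' ≤ t i x.1 ∧ r i x.1 ≤ ϱ (t i x.1)}) ∧
    (∀ (T : ℝ) (Th : Fin d.N → ℝ), τ₁ < T → (∀ j, τ₁ < Th j) →
      (∀ j (y : E4), T < y 0 → r j y ≤ Rc j (t j y) + 2 → Th j < t j y) →
      O \ (Φ '' {y | T < y.1 0 ∧ ∀ j, 5 * ρa j (y.1 0) < r j y.1} ∪
          ⋃ j, Ψa j '' {x | Th j < t j x.1 ∧ r j x.1 < Rc j (t j x.1) + 2}) ⊆
        𝓢.metric.causalPast 𝓢.timeOrientation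
          (Φ '' {y | y.1 0 = T ∧ ∀ j, 5 * ρa j (y.1 0) < r j y.1} ∪
            ⋃ j, Ψa j '' {x | t j x.1 = Th j ∧ r j x.1 < Rc j (t j x.1) + 2}))

/-- **Gap certificate of hole `i` above the wall profile `w`** (the conclusion of `NeckGapDecay` for one
hole, verbatim G1–G5, with the wall clause `3ρᵢ(s) + 2 ≤ W s` replaced by `w s ≤ W s`): `NeckGapDecay`
gives it with `w = 3ρᵢ + 2`, the re-excision bootstrap (S1) with `w = 3ρ' + 2` for every sublinear
majorant `ρ' ≥ ρᵢ`. -/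
def GapCertificateAt (𝓢 : Spacetime.{0} 4) (O : Set 𝓢.carrier) (d : FinalStateDecomposition 𝓢 O 4)
    (R₀ : ℝ) (i : Fin d.N) (w : ℝ → ℝ) : Prop :=
  ∃ (R₁ τ₁ : ℝ) (W : ℝ → ℝ) (Ψg : (d.background i).domain → 𝓢.carrier),
    let B := d.background i; let t := B.time; let r := B.radius;
    R₀ ≤ R₁ ∧ d.τ₀ ≤ τ₁ ∧ Continuous W ∧ (∀ s, τ₁ ≤ s → w s ≤ W s) ∧
    (let U : Set B.domain := {x | τ₁ < t x.1 ∧ r x.1 < W (x.1 0) + 1};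
      ContMDiffOn 𝓘(ℝ, E4) (𝓡 4) ∞ Ψg U ∧ Topology.IsOpenEmbedding (U.restrict Ψg) ∧ Ψg '' U ⊆ d.charted) ∧
    (∀ x : B.domain, r x.1 ≤ R₁ + 1 → Ψg x = d.chart i x) ∧
    Tendsto (fun τ ↦ supCkENorm (Subtype.val '' {x : B.domain | t x.1 = τ ∧ r x.1 ≤ W (x.1 0)}) 2
      (𝓢.deviationExtend B Ψg)) atTop (𝓝 0) ∧
    (∀ x : B.domain, τ₁ ≤ t x.1 → R₁ ≤ r x.1 → r x.1 ≤ W (x.1 0) →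
      𝓢.timeOrientation.IsFutureDirected
        (mfderiv 𝓘(ℝ, E4) (𝓡 4) Ψg x (((d.motion i).1 : E4 ≃L[ℝ] E4) (E4.basisVector 0)))) ∧
    (∀ (τ' : ℝ) (ϱ : ℝ → ℝ), Continuous ϱ → τ₁ < τ' →
      (∀ x : B.domain, τ' ≤ t x.1 → r x.1 ≤ ϱ (t x.1) → r x.1 ≤ W (x.1 0)) →
      closure (Ψg '' {x | τ' ≤ t x.1 ∧ r x.1 ≤ ϱ (t x.1)}) ∩ O ⊆ Ψg '' {x | τ' ≤ t x.1 ∧ r x.1 ≤ ϱ (t x.1)})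

/-! ## S1 — the re-excision bootstrap -/

/-- **(S1) Gap bootstrap**: for every honest `C⁴` input with distinct velocities and every hole `i`, the
gap certificate holds above `3ρ' + 2` for EVERY sublinear EVENTUAL majorant `ρ'` of `ρᵢ` (`ρᵢ s ≤ ρ' s`
for `s ≥ τm`; apply `NeckGapDecay` to the re-excised decomposition with the same charts, flat domain and
charted region and the excision `s ↦ if s < τm then ρᵢ s else ρ' s` at hole `i` — sublinear, `≥ ρᵢ`
pointwise, so `setOf_lt_excision_subset_flatDomain` survives; `Hc`, DV, `O` unchanged, `Hf`(2) antitone in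
the excision — and enlarge `τ₁` to `max τ₁ τm`; refuter rattack's `ReExcise.lean`, kernel-checked per item
note). -/
def GapBootstrap : Prop :=
  ∀ (X : Type) [TopologicalSpace X] [ChartedSpace E3 X] [IsManifold (𝓡 3) ∞ X] [ConnectedSpace X]
    (D : InitialDataSet (𝓡 3) X), D ∈ admissibleVacuumData X →
    ∀ 𝒟 : VacuumCauchyDevelopment D, 𝒟.IsMaximal →
    ∀ (O : Set 𝒟.carrier) (d : FinalStateDecomposition 𝒟.toSpacetime O 4) (R₀ : ℝ),
      O = exteriorOf 𝒟.toCauchyDevelopment d.charted →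
      HonestCore 𝒟.toSpacetime O 4 d R₀ → HonestFar 𝒟.toSpacetime O 4 d R₀ →
      DistinctVelocities 𝒟.toSpacetime O 4 d →
      ∀ (i : Fin d.N) (ρ' : ℝ → ℝ) (τm : ℝ), (∀ s, τm ≤ s → d.excision i s ≤ ρ' s) →
        Tendsto (fun s ↦ ρ' s / s) atTop (𝓝 0) →
        GapCertificateAt 𝒟.toSpacetime O d R₀ i (fun s ↦ 3 * ρ' s + 2)

/-- Stub S1 `NeckGapDecay → GapBootstrap` — LANDED (p137784,
`Theorems/StarvedNecksGapDecaySufficesStubGapBootstrap.lean`, re-excision by `max (ρⱼ) ρ'` at every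
hole, so the majorant hypothesis is not even needed). -/
theorem stub_gapBootstrap : Theses.StarvedNecks.NeckGapDecay → GapBootstrap :=
  Theorems.GapDecaySuffices.Bootstrap.stub_gapBootstrap

/-! ## S2 — far certification of the input flat chart against boosted Kerr -/

/-- The input flat chart transported to hole `i`'s model domain: `Φ` at coordinate points of the flat
domain, the input hole chart elsewhere (junk branch, never inspected). -/
def flatOnHole {𝓢 : Spacetime.{0} 4} {O : Set 𝓢.carrier} {k : ℕ} (d : FinalStateDecomposition 𝓢 O k)
    (i : Fin d.N) (x : (d.background i).domain) : 𝓢.carrier :=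
  open scoped Classical in
  if h : x.1 ∈ d.flatDomain then d.flatChart ⟨x.1, h⟩ else d.chart i x

/-- **(S2) Far certification**: on hole slabs `{tᵢ = τ, σ(τ) ≤ rᵢ ≤ σ'(τ)}` whose coordinate points are
late-flat (`τ₀ < y⁰`, off every excised tube with margin 1) with flat times `→ ∞` uniformly and
`σ → ∞`, the sup-`C²` deviation of `flatOnHole d i` from the boosted Kerr background `Bᵢ` tends to `0`
(flat `C⁴` certificate on flat slabs + the landed Kerr–Schild tail decay `KerrSchildTailDecay`). -/
def FlatFarCertified : Prop :=
  ∀ (𝓢 : Spacetime.{0} 4) (O : Set 𝓢.carrier) (d : FinalStateDecomposition 𝓢 O 4) (i : Fin d.N)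
    (σ σ' m : ℝ → ℝ) (τ₂ : ℝ),
    Kerr.IsSubextremal (d.mass i) (d.spin i) →
    Tendsto σ atTop atTop → Tendsto m atTop atTop →
    (∀ x : (d.background i).domain, τ₂ ≤ (d.background i).time x.1 →
      σ ((d.background i).time x.1) ≤ (d.background i).radius x.1 →
      (d.background i).radius x.1 ≤ σ' ((d.background i).time x.1) →
        m ((d.background i).time x.1) ≤ x.1 0 ∧ d.τ₀ < x.1 0 ∧
          ∀ j, d.excision j (x.1 0) + 1 ≤ (d.background j).radius x.1) →
    Tendsto (fun τ ↦ supCkENorm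
      (Subtype.val '' {x : (d.background i).domain | (d.background i).time x.1 = τ ∧
        σ τ ≤ (d.background i).radius x.1 ∧ (d.background i).radius x.1 ≤ σ' τ}) 2
      (𝓢.deviationExtend (d.background i) (flatOnHole d i))) atTop (𝓝 0)

/-- Stub S2 `FlatFarCertified` — LANDED (p138385,
`Theorems/StarvedNecksGapDecaySufficesStubFlatFarCertified.lean`; reusable helpers there:
`deviation_eq_of_eqOn_flat`, `deviationExtend_eventuallyEq_of_eqOn_flat`, `tendsto_biSup_ge_atTop_nhds_zero`). -/
theorem stub_flatFarCertified : FlatFarCertified :=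
  Theorems.GapDecaySuffices.FarCertified.stub_flatFarCertified

/-! ## S3 — the analytic core: inward switch-off of one near-isometry of `(E4, η)` -/

/-- pullback of a field of bilinear forms `g` (on the target) along `T`, minus a reference form `g₀` on
the domain: `(T^* g − g₀)(x) = g(T x)(DT x ·, DT x ·) − g₀ x`. -/
def pullbackMinus (g : E4 → E4 →L[ℝ] E4 →L[ℝ] ℝ) (T : E4 → E4) (g₀ : E4 → E4 →L[ℝ] E4 →L[ℝ] ℝ)
    (x : E4) : E4 →L[ℝ] E4 →L[ℝ] ℝ :=
  (g (T x)).bilinearComp (fderiv ℝ T x) (fderiv ℝ T x) - g₀ x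

/-- **(S3, two-metric form, v3) Inward switch-off.**  (v1 took the `η`-pullback defect of `T` as
hypothesis; that is NOT suppliable by the assembly in deep cores, where the gap chart's deviation `h₂` is
seen through `DT` — `work/S3-switchoff-analysis.md` §7(a).  Hence the exact-isometry form below.)  Rest-frame coordinates of one hole.  DATA: radii
`1 ≤ rin ≤ σ`, smooth, 1-Lipschitz, log-room `σ/rin → ∞`; a DOMAIN metric `η + h₁` on the collar box
`𝒞 = {τA < x⁰, ¾σ < |x̲| < 7/4σ}` and a TARGET metric `Bm + h₂` on the target box
`𝒯 = {τA < y⁰, |y̲| < 2σ}` with `h₁ → 0`, `h₂ → 0` in sup-`C²` on slabs and the background `Bm` (boosted Kerr in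
the assembly) `C²`-close to `η` on the slabs of `𝒯` beyond `rin/2`; a map `T`, smooth and injective on `𝒞`,
orientation- and time-orientation-preserving, coarsely located, which is an EXACT ISOMETRY
`T^*(Bm + h₂) = η + h₁` on `𝒞` (so its frames may be arbitrarily deep where `h₂` is seen through them —
nothing is assumed about `T^*η`).  CONCLUSION: one map `S` on the work box `𝒵 = {τA' < x⁰, |x̲| < 7/4σ}`,
`= id` on `|x̲| ≤ rin`, `= T` on `3/2σ ≤ |x̲|`, smooth injective open, coarsely located, mapping `𝒵` into `𝒯`,
with `S^*(Bm + h₂) − Bm → 0` in sup-`C²` on the slabs of `𝒵`. -/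
def SwitchOffInward : Prop :=
  ∀ (τA : ℝ) (rin σ κ : ℝ → ℝ) (T : E4 → E4) (h₁ h₂ Bm : E4 → E4 →L[ℝ] E4 →L[ℝ] ℝ),
    ContDiff ℝ ∞ rin → ContDiff ℝ ∞ σ →
    (∀ τ, |deriv rin τ| ≤ 1 ∧ |deriv σ τ| ≤ 1 ∧ 1 ≤ rin τ ∧ rin τ ≤ σ τ) →
    Tendsto (fun τ ↦ σ τ / rin τ) atTop atTop →
    Tendsto κ atTop (𝓝 0) →
    ContDiffOn ℝ ∞ (fun p : E4 × E4 ↦ Bm p.1 p.2)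
      ({y | τA < y 0 ∧ rin (y 0) / 2 < E4.spatialNorm y} ×ˢ univ) →
    ContDiffOn ℝ ∞ (fun p : E4 × E4 ↦ h₂ p.1 p.2)
      ({y | τA < y 0 ∧ rin (y 0) / 2 < E4.spatialNorm y} ×ˢ univ) →
    (let 𝒞 : Set E4 :=
        {x | τA < x 0 ∧ 3 / 4 * σ (x 0) < E4.spatialNorm x ∧ E4.spatialNorm x < 7 / 4 * σ (x 0)};
      let 𝒯 : Set E4 := {y | τA < y 0 ∧ E4.spatialNorm y < 2 * σ (y 0)};
      ContDiffOn ℝ ∞ T 𝒞 ∧ InjOn T 𝒞 ∧ MapsTo T 𝒞 𝒯 ∧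
      (∀ x ∈ 𝒞, 0 < LinearMap.det (fderiv ℝ T x : E4 →ₗ[ℝ] E4) ∧ 0 < fderiv ℝ T x (E4.basisVector 0) 0) ∧
      (∀ x ∈ 𝒞, |E4.spatialNorm (T x) - E4.spatialNorm x| ≤ κ (x 0) * σ (x 0) ∧
        |T x 0 - x 0| ≤ κ (x 0) * σ (x 0)) ∧
      (∀ x ∈ 𝒞, ∀ v w : E4,
        (Bm (T x) + h₂ (T x)) (fderiv ℝ T x v) (fderiv ℝ T x w) = (Minkowski.bilin + h₁ x) v w) ∧
      Tendsto (fun τ ↦ supCkENorm {x | x ∈ 𝒞 ∧ x 0 = τ} 2 h₁) atTop (𝓝 0) ∧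
      Tendsto (fun τ ↦ supCkENorm {y | y ∈ 𝒯 ∧ y 0 = τ} 2 h₂) atTop (𝓝 0) ∧
      Tendsto (fun τ ↦ supCkENorm {y | y ∈ 𝒯 ∧ y 0 = τ ∧ rin τ / 2 ≤ E4.spatialNorm y} 2
        (fun y ↦ Bm y - Minkowski.bilin)) atTop (𝓝 0)) →
    ∃ (τA' : ℝ) (κ' : ℝ → ℝ) (S : E4 → E4),
      let 𝒵 : Set E4 := {x | τA' < x 0 ∧ E4.spatialNorm x < 7 / 4 * σ (x 0)};
      let 𝒯 : Set E4 := {y | τA < y 0 ∧ E4.spatialNorm y < 2 * σ (y 0)};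
      τA ≤ τA' ∧ Tendsto κ' atTop (𝓝 0) ∧
      ContDiffOn ℝ ∞ S 𝒵 ∧ InjOn S 𝒵 ∧ IsOpenMap (𝒵.restrict S) ∧ MapsTo S 𝒵 𝒯 ∧
      (∀ x ∈ 𝒵, E4.spatialNorm x ≤ rin (x 0) → S x = x) ∧
      (∀ x ∈ 𝒵, 3 / 2 * σ (x 0) ≤ E4.spatialNorm x → S x = T x) ∧
      (∀ x ∈ 𝒵, |E4.spatialNorm (S x) - E4.spatialNorm x| ≤ κ' (x 0) * σ (x 0) ∧
        |S x 0 - x 0| ≤ κ' (x 0) * σ (x 0)) ∧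
      Tendsto (fun τ ↦ supCkENorm {x | x ∈ 𝒵 ∧ x 0 = τ} 2
        (pullbackMinus (fun y ↦ Bm y + h₂ y) S Bm)) atTop (𝓝 0)


/-- Registered stub S3 (the analytic core, held by the lead): `SwitchOffInward`. -/
theorem stub_switchOffInward : SwitchOffInward := by
  sorry

/-! ## Anchoring the labels (the misstatement boundary of the crux) -/

/-- **`TubeAnchoredR d R₀`** — radius-windowed anchoring of the flat tubes to the hole charts (cf. the
crux disprover's set-level `TubeAnchored`, `Cruxes/GapDecaySuffices/Disproof.lean` §4): eventually in
flat time, the flat image of the model collar `3ρᵢ(y⁰) + 2R₀ ≤ rᵢ y ≤ 4ρᵢ(y⁰) + 2R₀` around label line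
`i` is the INPUT hole chart `i`'s image of a LATE point of its honest cell `{R₀ ≤ rᵢ ≤ rⱼ ∀ j ≠ i}` whose
model RADIUS is within the window `[R₀, 9ρᵢ(y⁰) + 3R₀]` (margins absorb drift `< ρᵢ` and the 1/10
`C⁰` distortion of `Hf`(3)) ("the flat collar of tube `i` surrounds the hole of
chart `i`"; no clock window — an honest lab clock may lag by an unbounded `o(t)`).  Not a consequence
of Hc/Hf/DV (label-swapped honest binaries violate it: Disproof §2 `LabelSwapWitness`); satisfied by
every capture theorem's output. -/
def TubeAnchoredR {𝓢 : Spacetime.{0} 4} {O : Set 𝓢.carrier} {k : ℕ}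
    (d : FinalStateDecomposition 𝓢 O k) (R₀ : ℝ) : Prop :=
  ∀ i, ∃ T : ℝ, ∀ y : d.flatDomain, T ≤ y.1 0 →
    3 * d.excision i (y.1 0) + 2 * R₀ ≤ (d.background i).radius y.1 →
    (d.background i).radius y.1 ≤ 4 * d.excision i (y.1 0) + 2 * R₀ →
      ∃ x : (d.background i).domain, d.chart i x = d.flatChart y ∧
        d.τ₀ < (d.background i).time x.1 ∧ R₀ ≤ (d.background i).radius x.1 ∧
        (d.background i).radius x.1 ≤ 9 * d.excision i (y.1 0) + 3 * R₀ ∧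
        ∀ j, j ≠ i → (d.background i).radius x.1 ≤ (d.background j).radius x.1

/-- **Label matching** (the un-permuting / un-reflecting step every proof of the crux must contain,
Disproof §2 (ii)): every honest `C⁴` input with distinct velocities can be RELABELLED — hole charts
precomposed with model Poincaré maps permuting the label lines, labels transformed accordingly, flat
chart and flat domain untouched — into an honest input with the same charted region (hence the same
exterior) which is radius-anchored, has the same number of holes and eventually non-negative excision radii.
Topology (curvature exclusion + clopen continuation over the Causality API) + re-excision, XL–XXL for
permuted inputs; OR a one-line consequence of a future `Hf`(4) clause on the input (see
`LabelMatchingOfAnchored`). -/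
def LabelMatching : Prop :=
  ∀ (X : Type) [TopologicalSpace X] [ChartedSpace E3 X] [IsManifold (𝓡 3) ∞ X] [ConnectedSpace X]
    (D : InitialDataSet (𝓡 3) X), D ∈ admissibleVacuumData X →
    ∀ 𝒟 : VacuumCauchyDevelopment D, 𝒟.IsMaximal →
    ∀ (O : Set 𝒟.carrier) (d : FinalStateDecomposition 𝒟.toSpacetime O 4) (R₀ : ℝ),
      O = exteriorOf 𝒟.toCauchyDevelopment d.charted →
      HonestCore 𝒟.toSpacetime O 4 d R₀ → HonestFar 𝒟.toSpacetime O 4 d R₀ →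
      DistinctVelocities 𝒟.toSpacetime O 4 d →
      ∃ (d' : FinalStateDecomposition 𝒟.toSpacetime O 4) (R₀' : ℝ),
        d'.charted = d.charted ∧ d'.N = d.N ∧ d'.flatDomain = d.flatDomain ∧
          (∀ (y : E4) (hy : y ∈ d.flatDomain) (hy' : y ∈ d'.flatDomain),
            d'.flatChart ⟨y, hy'⟩ = d.flatChart ⟨y, hy⟩) ∧
          HonestCore 𝒟.toSpacetime O 4 d' R₀' ∧ HonestFar 𝒟.toSpacetime O 4 d' R₀' ∧
          DistinctVelocities 𝒟.toSpacetime O 4 d' ∧ TubeAnchoredR d' R₀' ∧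
          (∀ i, ∀ᶠ s in atTop, 0 ≤ d'.excision i s)

/-- Registered stub: `LabelMatching` (v8: with `d'.N = d.N` — wave-1 assembly finding — and eventually
non-negative excisions of the output — wave-1 S4′ finding X₃; both are `rfl`/free for the upstream repair
`Hf`(4)). -/
theorem stub_labelMatching : LabelMatching := by
  sorry

/-- **`LabelMatchingOfAnchored`** (v8): `LabelMatching` from the proposed input clause `Hf`(4) =
`TubeAnchoredR d R₀ ∧ ∀ i, ∀ᶠ s, 0 ≤ ρᵢ s` (radius anchoring with a non-degenerate window) — the
misstatement boundary of the crux made explicit.  PROVED below with `d' := d` (the `R₀' := R₀` form of the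
wave-2 LM worker's `labelMatching_of_tubeAnchoredR`, p146668).  PLANNER: with the restatement
`Hf := Hf ∧ TubeAnchoredR d R₀ ∧ ∀ i, ∀ᶠ s, 0 ≤ d.excision i s` of `NeckGapDecay` / `NecksCertifyR` the
registered stub `stub_labelMatching` is this theorem applied to `fun … hf … ↦ hf.2.2.2`. -/
def LabelMatchingOfAnchored : Prop :=
  (∀ (X : Type) [TopologicalSpace X] [ChartedSpace E3 X] [IsManifold (𝓡 3) ∞ X] [ConnectedSpace X]
      (D : InitialDataSet (𝓡 3) X), D ∈ admissibleVacuumData X →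
      ∀ 𝒟 : VacuumCauchyDevelopment D, 𝒟.IsMaximal →
      ∀ (O : Set 𝒟.carrier) (d : FinalStateDecomposition 𝒟.toSpacetime O 4) (R₀ : ℝ),
        O = exteriorOf 𝒟.toCauchyDevelopment d.charted →
        HonestCore 𝒟.toSpacetime O 4 d R₀ → HonestFar 𝒟.toSpacetime O 4 d R₀ →
        DistinctVelocities 𝒟.toSpacetime O 4 d →
        TubeAnchoredR d R₀ ∧ ∀ i, ∀ᶠ s in atTop, 0 ≤ d.excision i s) →
  LabelMatching

/-- `LabelMatching` from the proposed input clause `Hf`(4) (v8 form), with `d' := d`. -/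
theorem labelMatching_of_tubeAnchoredR_same : LabelMatchingOfAnchored := by
  intro hA X _ _ _ _ D hD 𝒟 h𝒟 O d R₀ hO hc hf hdv
  obtain ⟨hanch, hnn⟩ := hA X D hD 𝒟 h𝒟 O d R₀ hO hc hf hdv
  exact ⟨d, R₀, rfl, rfl, rfl, fun _ _ _ ↦ rfl, hc, hf, hdv, hanch, hnn⟩

/-! ## S4 — anchored location of the gap chart's collar in the flat chart's image (v8: inputs with a
## non-degenerate anchoring window, `ρᵢ ≥ 0` eventually; S4′ reduced further by the wave-1 worker) -/

/-- **(S4) Anchored location (reverse entry with coarse clock / radius control)**.  For every honest,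
RADIUS-ANCHORED (`TubeAnchoredR`, non-degenerate window: `ρᵢ ≥ 0` eventually — v8) `C⁴` input with distinct velocities and every hole `i` there is a sublinear KINEMATIC MAJORANT `Bᵢ` (clock
offset + drift + excision of the input flat chart relative to the input hole chart; `Bᵢ(s)/s → 0`) such
that for every monotone continuous CONCAVE (slope `→ 0`; a staircase `ρ'` read at two clocks is the
wave-1 counterexample) sublinear profile `ρ'` dominating it in ratio (`Bᵢ/ρ' → 0`, hence eventually
`ρᵢ + 1 ≤ ρ'`) and every gap certificate of hole `i` above `3ρ' + 2` (G1–G5 verbatim), after a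
later time `τ₂`: every coordinate point `y` of the model collar
`{τ₂ < tᵢ y, (11/10)ρ'(y⁰) ≤ rᵢ y ≤ (29/10)ρ'(y⁰)}` is late-flat off every excised tube with margin 1,
and its flat image is the gap-chart image of a point `x` of the same model domain with `τ₁ < tᵢ x`,
`rᵢ x < W(x⁰)`, whose hole clock and radius are within `κ(tᵢ y)·ρ'(y⁰)` of those of `y`, `κ → 0`
(anchored clopen continuation along the connected late band + Kretschmann exclusion + confinement /
Landau–Kolmogorov kinematics; cards `curvature-anchored-location`, `neck-timeline-anchoring`). -/
def AnchoredLocationP : Prop :=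
  ∀ (X : Type) [TopologicalSpace X] [ChartedSpace E3 X] [IsManifold (𝓡 3) ∞ X] [ConnectedSpace X]
    (D : InitialDataSet (𝓡 3) X), D ∈ admissibleVacuumData X →
    ∀ 𝒟 : VacuumCauchyDevelopment D, 𝒟.IsMaximal →
    ∀ (O : Set 𝒟.carrier) (d : FinalStateDecomposition 𝒟.toSpacetime O 4) (R₀ : ℝ),
      O = exteriorOf 𝒟.toCauchyDevelopment d.charted →
      HonestCore 𝒟.toSpacetime O 4 d R₀ → HonestFar 𝒟.toSpacetime O 4 d R₀ →
      DistinctVelocities 𝒟.toSpacetime O 4 d → TubeAnchoredR d R₀ →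
      ∀ i : Fin d.N, (∀ᶠ s in atTop, 0 ≤ d.excision i s) →
      ∃ Bk : ℝ → ℝ, Tendsto (fun s ↦ Bk s / s) atTop (𝓝 0) ∧
      ∀ (ρ' : ℝ → ℝ), Monotone ρ' → Continuous ρ' → ConcaveOn ℝ (Set.Ici 0) ρ' →
        Tendsto (fun s ↦ ρ' s / s) atTop (𝓝 0) →
        Tendsto (fun s ↦ Bk s / ρ' s) atTop (𝓝 0) → (∀ s, 1 ≤ ρ' s) →
      ∀ (R₁ τ₁ : ℝ) (W : ℝ → ℝ) (Ψg : (d.background i).domain → 𝒟.carrier),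
        let B := d.background i; let t := B.time; let r := B.radius;
        R₀ ≤ R₁ → d.τ₀ ≤ τ₁ → Continuous W → (∀ s, τ₁ ≤ s → 3 * ρ' s + 2 ≤ W s) →
        (let U : Set B.domain := {x | τ₁ < t x.1 ∧ r x.1 < W (x.1 0) + 1};
          ContMDiffOn 𝓘(ℝ, E4) (𝓡 4) ∞ Ψg U ∧ Topology.IsOpenEmbedding (U.restrict Ψg) ∧
            Ψg '' U ⊆ d.charted) →
        (∀ x : B.domain, r x.1 ≤ R₁ + 1 → Ψg x = d.chart i x) →
        Tendsto (fun τ ↦ supCkENorm (Subtype.val '' {x : B.domain | t x.1 = τ ∧ r x.1 ≤ W (x.1 0)}) 2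
          (𝒟.toSpacetime.deviationExtend B Ψg)) atTop (𝓝 0) →
        (∀ x : B.domain, τ₁ ≤ t x.1 → R₁ ≤ r x.1 → r x.1 ≤ W (x.1 0) →
          𝒟.toSpacetime.timeOrientation.IsFutureDirected
            (mfderiv 𝓘(ℝ, E4) (𝓡 4) Ψg x (((d.motion i).1 : E4 ≃L[ℝ] E4) (E4.basisVector 0)))) →
        (∀ (τ' : ℝ) (ϱ : ℝ → ℝ), Continuous ϱ → τ₁ < τ' →
          (∀ x : B.domain, τ' ≤ t x.1 → r x.1 ≤ ϱ (t x.1) → r x.1 ≤ W (x.1 0)) →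
          closure (Ψg '' {x | τ' ≤ t x.1 ∧ r x.1 ≤ ϱ (t x.1)}) ∩ O ⊆
            Ψg '' {x | τ' ≤ t x.1 ∧ r x.1 ≤ ϱ (t x.1)}) →
        ∃ (τ₂ : ℝ) (κ : ℝ → ℝ), τ₁ ≤ τ₂ ∧ Tendsto κ atTop (𝓝 0) ∧
          ∀ (y : E4) (hy : y ∈ B.domain), τ₂ < t y → 11 / 10 * ρ' (y 0) ≤ r y →
            r y ≤ 29 / 10 * ρ' (y 0) →
            ∃ hy' : y ∈ d.flatDomain, d.τ₀ < y 0 ∧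
              (∀ j, d.excision j (y 0) + 1 ≤ (d.background j).radius y) ∧
              ∃ x : B.domain, τ₁ < t x.1 ∧ r x.1 < W (x.1 0) ∧ Ψg x = d.flatChart ⟨y, hy'⟩ ∧
                |t x.1 - t y| ≤ κ (t y) * ρ' (y 0) ∧ |r x.1 - r y| ≤ κ (t y) * ρ' (y 0)

/-- **`SeededLocation` — the isolated remaining input of S4** (same antecedents as
`AnchoredLocation`, verbatim, up to and including G5).  CONCLUSION: a flat time `T`, an admissible
closed gap tube `{τ' ≤ tᵢ, rᵢ ≤ ϱ(tᵢ)}` (`τ₁ < τ'`, `ϱ` continuous, `rᵢ ≤ ϱ(tᵢ) ⟹ rᵢ < W(x⁰)`), a seed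
radius profile `rs` (`R₀ ≤ rs`, `ρᵢ < rs < 1.1ρ'` after `T`) and `κ → 0` with: (seed spheres) flat
points `z`, `z⁰ ≥ T`, `rᵢ z = rs(z⁰)`, have `Φ z` in the `Ψg`-image of the open tube; (no rim contact)
closed-tube preimages of `Φ z`, `z` flat with `z⁰ ≥ T`, `rs(z⁰) ≤ rᵢ z ≤ 2.9ρ'(z⁰)`, lie in the open
tube; (location) open-tube preimages of collar points `1.1ρ'(z⁰) ≤ rᵢ z ≤ 2.9ρ'(z⁰)`, `z⁰ ≥ T`, have
hole clock and radius within `κ(tᵢ z)·ρ'(z⁰)` of those of `z`. -/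
def SeededLocationP : Prop :=
  ∀ (X : Type) [TopologicalSpace X] [ChartedSpace E3 X] [IsManifold (𝓡 3) ∞ X] [ConnectedSpace X]
    (D : InitialDataSet (𝓡 3) X), D ∈ admissibleVacuumData X →
    ∀ 𝒟 : VacuumCauchyDevelopment D, 𝒟.IsMaximal →
    ∀ (O : Set 𝒟.carrier) (d : FinalStateDecomposition 𝒟.toSpacetime O 4) (R₀ : ℝ),
      O = exteriorOf 𝒟.toCauchyDevelopment d.charted →
      HonestCore 𝒟.toSpacetime O 4 d R₀ → HonestFar 𝒟.toSpacetime O 4 d R₀ →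
      DistinctVelocities 𝒟.toSpacetime O 4 d → TubeAnchoredR d R₀ →
      ∀ i : Fin d.N, (∀ᶠ s in atTop, 0 ≤ d.excision i s) →
      ∃ Bk : ℝ → ℝ, Tendsto (fun s ↦ Bk s / s) atTop (𝓝 0) ∧
      ∀ (ρ' : ℝ → ℝ), Monotone ρ' → Continuous ρ' → ConcaveOn ℝ (Set.Ici 0) ρ' →
        Tendsto (fun s ↦ ρ' s / s) atTop (𝓝 0) →
        Tendsto (fun s ↦ Bk s / ρ' s) atTop (𝓝 0) → (∀ s, 1 ≤ ρ' s) →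
      ∀ (R₁ τ₁ : ℝ) (W : ℝ → ℝ) (Ψg : (d.background i).domain → 𝒟.carrier),
        let B := d.background i; let t := B.time; let r := B.radius;
        R₀ ≤ R₁ → d.τ₀ ≤ τ₁ → Continuous W → (∀ s, τ₁ ≤ s → 3 * ρ' s + 2 ≤ W s) →
        (let U : Set B.domain := {x | τ₁ < t x.1 ∧ r x.1 < W (x.1 0) + 1};
          ContMDiffOn 𝓘(ℝ, E4) (𝓡 4) ∞ Ψg U ∧ Topology.IsOpenEmbedding (U.restrict Ψg) ∧
            Ψg '' U ⊆ d.charted) →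
        (∀ x : B.domain, r x.1 ≤ R₁ + 1 → Ψg x = d.chart i x) →
        Tendsto (fun τ ↦ supCkENorm (Subtype.val '' {x : B.domain | t x.1 = τ ∧ r x.1 ≤ W (x.1 0)}) 2
          (𝒟.toSpacetime.deviationExtend B Ψg)) atTop (𝓝 0) →
        (∀ x : B.domain, τ₁ ≤ t x.1 → R₁ ≤ r x.1 → r x.1 ≤ W (x.1 0) →
          𝒟.toSpacetime.timeOrientation.IsFutureDirected
            (mfderiv 𝓘(ℝ, E4) (𝓡 4) Ψg x (((d.motion i).1 : E4 ≃L[ℝ] E4) (E4.basisVector 0)))) →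
        (∀ (τ' : ℝ) (ϱ : ℝ → ℝ), Continuous ϱ → τ₁ < τ' →
          (∀ x : B.domain, τ' ≤ t x.1 → r x.1 ≤ ϱ (t x.1) → r x.1 ≤ W (x.1 0)) →
          closure (Ψg '' {x | τ' ≤ t x.1 ∧ r x.1 ≤ ϱ (t x.1)}) ∩ O ⊆
            Ψg '' {x | τ' ≤ t x.1 ∧ r x.1 ≤ ϱ (t x.1)}) →
        ∃ (T τ' : ℝ) (ϱ rs κ : ℝ → ℝ), τ₁ < τ' ∧ Continuous ϱ ∧ Tendsto κ atTop (𝓝 0) ∧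
          (∀ x : B.domain, τ' ≤ t x.1 → r x.1 ≤ ϱ (t x.1) → r x.1 < W (x.1 0)) ∧
          (∀ s, T ≤ s → R₀ ≤ rs s ∧ d.excision i s < rs s ∧ rs s < 11 / 10 * ρ' s) ∧
          (∀ (z : E4) (hz : z ∈ d.flatDomain), T ≤ z 0 → r z = rs (z 0) →
            ∃ x : B.domain, τ' < t x.1 ∧ r x.1 < ϱ (t x.1) ∧ Ψg x = d.flatChart ⟨z, hz⟩) ∧
          (∀ (z : E4) (hz : z ∈ d.flatDomain), T ≤ z 0 → rs (z 0) ≤ r z →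
            r z ≤ 29 / 10 * ρ' (z 0) →
            ∀ x : B.domain, τ' ≤ t x.1 → r x.1 ≤ ϱ (t x.1) → Ψg x = d.flatChart ⟨z, hz⟩ →
              τ' < t x.1 ∧ r x.1 < ϱ (t x.1)) ∧
          (∀ (z : E4) (hz : z ∈ d.flatDomain), T ≤ z 0 → 11 / 10 * ρ' (z 0) ≤ r z →
            r z ≤ 29 / 10 * ρ' (z 0) →
            ∀ x : B.domain, τ' < t x.1 → r x.1 < ϱ (t x.1) → Ψg x = d.flatChart ⟨z, hz⟩ →
              |t x.1 - t z| ≤ κ (t z) * ρ' (z 0) ∧ |r x.1 - r z| ≤ κ (t z) * ρ' (z 0))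

/-! ### S4″ — the wave-1 reduction of `SeededLocationP` (c1 worker; files `work/stubs/StubSeededLocation{Band,Kinematics,Inputs,Main}.lean`) -/

/-- **X₁ `UniformLocation` — the analytic residue of S4′ (located-ness of ALL late common points of
the flat band and the honest gap region).**  Antecedents: those of `SeededLocation` VERBATIM through
G5, plus the non-degeneracy `∀ᶠ s, 0 ≤ ρᵢ s` of the anchoring window (`EventuallyNonnegExcision`).
CONCLUSION: a flat time `T`, a hole time `τ₂` and an antitone `κ → 0` such that for every late-flat
coordinate point `z` of the flat band — `T ≤ z⁰`, `τ₀ < z⁰`, `3ρᵢ(z⁰) + 2R₀ ≤ rᵢ z ≤ 2.9ρ'(z⁰)` (from the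
inner radius of the anchoring window out to the collar), off every other excised tube with margin
`1` — and every point `x` of the HONEST part `{τ₂ ≤ tᵢ, rᵢ ≤ W(x⁰)}` (the G3/G4 region) of the gap
tube with `Ψg x = Φ z`, the hole clock and radius of `x` are within `κ(z⁰)ρ'(z⁰)` of those of `z`
(`x` is unique by G1).  WHY TRUE / WHAT IT NEEDS (on paper): a COARSE two-sided interval comparison
for the transition `k = Ψg⁻¹ ∘ Φ` (exact isometry `η + h₁ → Bₘ + h₂`, `h₁, h₂ → 0`, Kerr tail `M/ρ'`)
WITHOUT an a-priori `‖Dk‖` bound — honest boost-flash plates exist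
(`NegativeNotes-honest-vortex-flash-gauges` (E); a flash displaces by `≲ 1/δ ≪ κρ'`), the lead's open
E4-level point; then `QAZ.stub_quantAlexandrovZeeman` on balls of radius `~ρ'/C` chained along the
band; pinning of the fitted Poincaré maps to the declared axis by `TubeAnchoredR` over flat-time
spans `≫ Bk` (relative boost `→ 1`, transverse offset `o(ρ')`); the residual clock offset is absorbed
into THIS statement's `∃ Bk`; lateness / location of `x` near `τ₂` from the coarse fit (the honest
slab `{tᵢ = const ≥ τ₂, rᵢ ≤ W}` is uniformly spacelike, so its flat times spread by `O(ρ')` only);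
entry (`flat_entry_gapTube`, p143739) to have `k` defined on the balls.  L–XL for one worker given
the E4-level comparison lemma; everything else in it is the manifold bookkeeping of this line. -/
def UniformLocation : Prop :=
  ∀ (X : Type) [TopologicalSpace X] [ChartedSpace E3 X] [IsManifold (𝓡 3) ∞ X] [ConnectedSpace X]
    (D : InitialDataSet (𝓡 3) X), D ∈ admissibleVacuumData X →
    ∀ 𝒟 : VacuumCauchyDevelopment D, 𝒟.IsMaximal →
    ∀ (O : Set 𝒟.carrier) (d : FinalStateDecomposition 𝒟.toSpacetime O 4) (R₀ : ℝ),
      O = exteriorOf 𝒟.toCauchyDevelopment d.charted →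
      HonestCore 𝒟.toSpacetime O 4 d R₀ → HonestFar 𝒟.toSpacetime O 4 d R₀ →
      DistinctVelocities 𝒟.toSpacetime O 4 d → TubeAnchoredR d R₀ →
      ∀ i : Fin d.N, (∀ᶠ s in atTop, 0 ≤ d.excision i s) →
      ∃ Bk : ℝ → ℝ, Tendsto (fun s ↦ Bk s / s) atTop (𝓝 0) ∧
      ∀ (ρ' : ℝ → ℝ), Monotone ρ' → Continuous ρ' → ConcaveOn ℝ (Set.Ici 0) ρ' →
        Tendsto (fun s ↦ ρ' s / s) atTop (𝓝 0) →
        Tendsto (fun s ↦ Bk s / ρ' s) atTop (𝓝 0) → (∀ s, 1 ≤ ρ' s) →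
      ∀ (R₁ τ₁ : ℝ) (W : ℝ → ℝ) (Ψg : (d.background i).domain → 𝒟.carrier),
        let B := d.background i; let t := B.time; let r := B.radius;
        R₀ ≤ R₁ → d.τ₀ ≤ τ₁ → Continuous W → (∀ s, τ₁ ≤ s → 3 * ρ' s + 2 ≤ W s) →
        (let U : Set B.domain := {x | τ₁ < t x.1 ∧ r x.1 < W (x.1 0) + 1};
          ContMDiffOn 𝓘(ℝ, E4) (𝓡 4) ∞ Ψg U ∧ Topology.IsOpenEmbedding (U.restrict Ψg) ∧
            Ψg '' U ⊆ d.charted) →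
        (∀ x : B.domain, r x.1 ≤ R₁ + 1 → Ψg x = d.chart i x) →
        Tendsto (fun τ ↦ supCkENorm (Subtype.val '' {x : B.domain | t x.1 = τ ∧ r x.1 ≤ W (x.1 0)}) 2
          (𝒟.toSpacetime.deviationExtend B Ψg)) atTop (𝓝 0) →
        (∀ x : B.domain, τ₁ ≤ t x.1 → R₁ ≤ r x.1 → r x.1 ≤ W (x.1 0) →
          𝒟.toSpacetime.timeOrientation.IsFutureDirected
            (mfderiv 𝓘(ℝ, E4) (𝓡 4) Ψg x (((d.motion i).1 : E4 ≃L[ℝ] E4) (E4.basisVector 0)))) →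
        (∀ (τ' : ℝ) (ϱ : ℝ → ℝ), Continuous ϱ → τ₁ < τ' →
          (∀ x : B.domain, τ' ≤ t x.1 → r x.1 ≤ ϱ (t x.1) → r x.1 ≤ W (x.1 0)) →
          closure (Ψg '' {x | τ' ≤ t x.1 ∧ r x.1 ≤ ϱ (t x.1)}) ∩ O ⊆
            Ψg '' {x | τ' ≤ t x.1 ∧ r x.1 ≤ ϱ (t x.1)}) →
        ∃ (T τ₂ : ℝ) (κ : ℝ → ℝ), Antitone κ ∧ Tendsto κ atTop (𝓝 0) ∧
          ∀ (z : E4) (hz : z ∈ d.flatDomain), T ≤ z 0 → d.τ₀ < z 0 →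
            3 * d.excision i (z 0) + 2 * R₀ ≤ r z → r z ≤ 29 / 10 * ρ' (z 0) →
            (∀ j, j ≠ i → d.excision j (z 0) + 1 ≤ (d.background j).radius z) →
            ∀ x : B.domain, τ₂ ≤ t x.1 → r x.1 ≤ W (x.1 0) → Ψg x = d.flatChart ⟨z, hz⟩ →
              |t x.1 - t z| ≤ κ (z 0) * ρ' (z 0) ∧ |r x.1 - r z| ≤ κ (z 0) * ρ' (z 0)

/-- **X₂ `LateSeed` — ONE late common point at the anchoring window (seed transport through the
input hole chart).**  Antecedents: those of `SeededLocation` VERBATIM through G5, plus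
`∀ᶠ s, 0 ≤ ρᵢ s`.  CONCLUSION: for every flat time `T` and hole time `τ₂` there is a flat-domain point
`z` of the anchoring window `3ρᵢ(z⁰) + 2R₀ ≤ rᵢ z ≤ 4ρᵢ(z⁰) + 2R₀`, `T ≤ z⁰`, whose flat image is `Ψg x`
for a point `x` of the honest gap region `{τ₂ ≤ tᵢ, rᵢ ≤ W(x⁰)}`.  WHY TRUE / WHAT IT NEEDS: a late
flat time `s ≥ T` with `ρᵢ(s) ≥ 0` beyond the threshold of `TubeAnchoredR`; the window point is
late-flat (`lateFlat_band`) and has an anchored `Ψᵢ`-preimage `x`, `R₀ ≤ rᵢ x ≤ 9ρᵢ(s) + 3R₀`.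
(a) If `rᵢ x` stays BOUNDED along a sequence of such `s → ∞` (e.g. `liminf ρᵢ < ∞`): lateness
`tᵢ x → ∞` is COMPACTNESS — a limit point of `Ψᵢ xₙ = Φ yₙ`, `yₙ⁰ → ∞`, `xₙ` in the compact
`{τ₀ ≤ tᵢ ≤ τ₂, R₀ ≤ rᵢ ≤ L}`, would by `Hf`(2) have late flat preimages of EVERY lateness, contradicting
injectivity of `Φ` on the late flat domain — and then `x⁰ → ∞` (clock bound), `W(x⁰) ≥ 3ρ'(x⁰) + 2 → ∞`
(`ρ' → ∞` is forced by `Bk ≥ 1`), so eventually `rᵢ x ≤ R₁ + 1 ≤ W(x⁰)` and `Ψg x = Ψᵢ x` (G2): M-sized.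
(b) If `ρᵢ → ∞`: transport `Ψᵢ x` into `Ψg`'s honest region through the honest band
(`hole_entry_gapTube`, seeded by G2 inside `R₁ + 1`, no rim contact from the 1/10 honesty `Hf`(3) of
`Ψᵢ` and G3 of `Ψg` against the SAME background, wall `3ρ' + 2 ≫ 9ρᵢ + 3R₀` by this statement's `Bk`)
AND a coarse CLOCK-RATE comparison `x⁰ ≳ y⁰/C` between the two charts (to read the wall at the right
time and to get lateness), which the typed `TubeAnchoredR` withholds ("no clock window"): L-sized.
SUGGESTION for the misstatement boundary `Hf`(4) (= `LabelMatching`'s output): add the physically free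
coarse clock window `y⁰ ≤ C·(tᵢ x + 1)` to the conclusion of `TubeAnchoredR`; then (b) reduces to (a)'s
bookkeeping plus the band transport. -/
def LateSeed : Prop :=
  ∀ (X : Type) [TopologicalSpace X] [ChartedSpace E3 X] [IsManifold (𝓡 3) ∞ X] [ConnectedSpace X]
    (D : InitialDataSet (𝓡 3) X), D ∈ admissibleVacuumData X →
    ∀ 𝒟 : VacuumCauchyDevelopment D, 𝒟.IsMaximal →
    ∀ (O : Set 𝒟.carrier) (d : FinalStateDecomposition 𝒟.toSpacetime O 4) (R₀ : ℝ),
      O = exteriorOf 𝒟.toCauchyDevelopment d.charted →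
      HonestCore 𝒟.toSpacetime O 4 d R₀ → HonestFar 𝒟.toSpacetime O 4 d R₀ →
      DistinctVelocities 𝒟.toSpacetime O 4 d → TubeAnchoredR d R₀ →
      ∀ i : Fin d.N, (∀ᶠ s in atTop, 0 ≤ d.excision i s) →
      ∃ Bk : ℝ → ℝ, Tendsto (fun s ↦ Bk s / s) atTop (𝓝 0) ∧
      ∀ (ρ' : ℝ → ℝ), Monotone ρ' → Continuous ρ' → ConcaveOn ℝ (Set.Ici 0) ρ' →
        Tendsto (fun s ↦ ρ' s / s) atTop (𝓝 0) →
        Tendsto (fun s ↦ Bk s / ρ' s) atTop (𝓝 0) → (∀ s, 1 ≤ ρ' s) →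
      ∀ (R₁ τ₁ : ℝ) (W : ℝ → ℝ) (Ψg : (d.background i).domain → 𝒟.carrier),
        let B := d.background i; let t := B.time; let r := B.radius;
        R₀ ≤ R₁ → d.τ₀ ≤ τ₁ → Continuous W → (∀ s, τ₁ ≤ s → 3 * ρ' s + 2 ≤ W s) →
        (let U : Set B.domain := {x | τ₁ < t x.1 ∧ r x.1 < W (x.1 0) + 1};
          ContMDiffOn 𝓘(ℝ, E4) (𝓡 4) ∞ Ψg U ∧ Topology.IsOpenEmbedding (U.restrict Ψg) ∧
            Ψg '' U ⊆ d.charted) →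
        (∀ x : B.domain, r x.1 ≤ R₁ + 1 → Ψg x = d.chart i x) →
        Tendsto (fun τ ↦ supCkENorm (Subtype.val '' {x : B.domain | t x.1 = τ ∧ r x.1 ≤ W (x.1 0)}) 2
          (𝒟.toSpacetime.deviationExtend B Ψg)) atTop (𝓝 0) →
        (∀ x : B.domain, τ₁ ≤ t x.1 → R₁ ≤ r x.1 → r x.1 ≤ W (x.1 0) →
          𝒟.toSpacetime.timeOrientation.IsFutureDirected
            (mfderiv 𝓘(ℝ, E4) (𝓡 4) Ψg x (((d.motion i).1 : E4 ≃L[ℝ] E4) (E4.basisVector 0)))) →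
        (∀ (τ' : ℝ) (ϱ : ℝ → ℝ), Continuous ϱ → τ₁ < τ' →
          (∀ x : B.domain, τ' ≤ t x.1 → r x.1 ≤ ϱ (t x.1) → r x.1 ≤ W (x.1 0)) →
          closure (Ψg '' {x | τ' ≤ t x.1 ∧ r x.1 ≤ ϱ (t x.1)}) ∩ O ⊆
            Ψg '' {x | τ' ≤ t x.1 ∧ r x.1 ≤ ϱ (t x.1)}) →
        ∀ T τ₂ : ℝ, ∃ (z : E4) (hz : z ∈ d.flatDomain), T ≤ z 0 ∧
          3 * d.excision i (z 0) + 2 * R₀ ≤ r z ∧ r z ≤ 4 * d.excision i (z 0) + 2 * R₀ ∧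
          ∃ x : B.domain, τ₂ ≤ t x.1 ∧ r x.1 ≤ W (x.1 0) ∧ Ψg x = d.flatChart ⟨z, hz⟩

/-- Registered stub S4″a (the analytic residue of location: coarse interval comparison through flashes +
QAZ chaining + axis pinning), L–XL. -/
theorem stub_uniformLocation : UniformLocation := by
  sorry

/-- Registered stub S4″b (one late common point at the anchoring window: seed transport through the input
hole chart's honest band / compactness), M–L. -/
theorem stub_lateSeed : LateSeed := by
  sorry

/-- Registered reduction header (c1 wave-1 S4′ worker, KERNEL-CHECKED in `work/stubs/StubSeededLocationMain.lean`
as `…Theorems.GapDecaySuffices.Location.Seeded.seededLocationP_of_uniformLocation`; body `sorry` here until its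
files land — LANDED p168266, with Band p167503 and Inputs p167597): `SeededLocationP` from `UniformLocation` and `LateSeed` (Bk := theirs + window majorant, seed sphere
via outward constant-lab-time rays + `flat_entry_gapTube`, admissible tube below the wall by concavity). -/
theorem seededLocationP_of_uniformLocation : UniformLocation → LateSeed → SeededLocationP :=
  Theorems.GapDecaySuffices.Location.Seeded.seededLocationP_of_uniformLocation

/-- Registered reduction header (mechanical per-input variant of the LANDED p145261
`…AnchoredV2.anchoredLocation_of_seededLocation` with the non-negativity hypothesis threaded through; its
proof uses the hypothesis `hX` only at the same input): `AnchoredLocationP` from `SeededLocationP` — LANDED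
p166857 (lead c1, `Theorems/StarvedNecksGapDecaySufficesStubAnchoredLocationP.lean`). -/
theorem anchoredLocationP_of_seededLocationP : SeededLocationP → AnchoredLocationP :=
  Theorems.GapDecaySuffices.Location.AnchoredP.anchoredLocationP_of_seededLocationP

/-- S4′ `stub_seededLocation` (registered name kept; v8 signature `SeededLocationP`), DERIVED. -/
theorem stub_seededLocation : SeededLocationP :=
  seededLocationP_of_uniformLocation stub_uniformLocation stub_lateSeed

/-- S4 `stub_anchoredLocation` (v8 signature `AnchoredLocationP`), DERIVED. -/
theorem stub_anchoredLocation : AnchoredLocationP :=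
  anchoredLocationP_of_seededLocationP stub_seededLocation

/-! ## S5 — relabelling + chart assembly + K10–K13 bookkeeping (v7: parity-safe interface) -/

/-- `FlatTubesClosed` = the crux's `Hf`(2) ALONE (verbatim): late flat images off the excised tubes (margin 1)
are relatively closed in the late flat image.  This is the ONLY clause of `HonestFar` the landed seam
`…Seam.stub_seamSurgery` consumes when `0 < d.N` (`obtain ⟨-, hf2, -⟩ := hf`), and it TRANSFERS under the
per-label parity relabelling `relabelEach` (flat chart, flat domain and excisions unchanged) — unlike `Hf`(3),
whose honest cell `{R₀ ≤ rᵢ ≤ rⱼ}` is not invariant under the reflection `Q̃ᵢ` for `d.N ≥ 2` (lead c2, F6). -/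
def FlatTubesClosed (𝓢 : Spacetime.{0} 4) (O : Set 𝓢.carrier) (k : ℕ) (d : FinalStateDecomposition 𝓢 O k) :
    Prop :=
  ∀ τ' : ℝ, d.τ₀ < τ' →
    closure (d.flatChart '' {y | τ' ≤ y.1 0 ∧ ∀ i, d.excision i (y.1 0) + 1 ≤ (d.background i).radius y.1}) ⊆
      d.flatChart '' {y | τ' ≤ y.1 0}

/-- Linear CONE SEPARATION of the label lines (verbatim the unfolded antecedent of the landed
`…Bookkeeping.stub_chartSurgery`; supplied by the landed `…Cones.stub_coneSeparation`, p106992). -/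
def ConeSeparated (𝓢 : Spacetime.{0} 4) (O : Set 𝓢.carrier) (k : ℕ) (d : FinalStateDecomposition 𝓢 O k) :
    Prop :=
  ∃ c : ℝ, 0 < c ∧ ∃ τc : ℝ, ∀ (i j : Fin d.N) (y : E4), i ≠ j → τc ≤ y 0 →
    (d.background i).radius y ≤ c * y 0 → c * y 0 < (d.background j).radius y

/-- `NeckAtlas` = A1–A13 of the v5 skeleton (verbatim the `let`-bundle of the landed
`…Bookkeeping.stub_chartSurgery` / `…Seam.stub_seamSurgery`). -/
def NeckAtlas (𝓢 : Spacetime.{0} 4) (O : Set 𝓢.carrier) (d : FinalStateDecomposition 𝓢 O 4)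
    (R₀ : ℝ) : Prop :=
  let B := d.background; let t := fun i ↦ (B i).time; let r := fun i ↦ (B i).radius
  let Λ := fun i ↦ ((d.motion i).1 : E4 ≃L[ℝ] E4); let Φ := d.flatChart; let Ψ := d.chart
  let ρ := d.excision
  ∃ (R₁ τ₁ : ℝ) (ρ' Rg : Fin d.N → ℝ → ℝ) (Ψ' : ∀ i, (B i).domain → 𝓢.carrier),
    R₀ ≤ R₁ ∧ d.τ₀ ≤ τ₁ ∧
    (∀ i, Continuous (ρ' i) ∧ Tendsto (fun s ↦ ρ' i s / s) atTop (𝓝 0) ∧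
      ∀ s, R₁ + 1 ≤ ρ' i s ∧ (τ₁ ≤ s → ρ i s + 1 ≤ ρ' i s)) ∧
    (∀ i, Monotone (Rg i) ∧ Continuous (Rg i) ∧ Tendsto (fun s ↦ Rg i s / s) atTop (𝓝 0) ∧
      ∀ s, R₁ + 4 ≤ Rg i s) ∧
    (∀ j (y : E4), τ₁ ≤ y 0 → r j y ≤ ρ' j (y 0) → r j y + 3 ≤ Rg j (t j y)) ∧
    (∀ i, let U : Set (B i).domain := {x | τ₁ < t i x.1 ∧ r i x.1 < Rg i (t i x.1) + 2}
      ContMDiffOn 𝓘(ℝ, E4) (𝓡 4) ∞ (Ψ' i) U ∧ IsOpenEmbedding (U.restrict (Ψ' i)) ∧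
        Ψ' i '' U ⊆ d.charted) ∧
    (∀ i (x : (B i).domain), r i x.1 ≤ R₁ + 1 → Ψ' i x = Ψ i x) ∧
    (∀ i (y : E4) (hy : y ∈ (B i).domain), τ₁ ≤ y 0 → (∀ j, ρ' j (y 0) < r j y) →
      r i y ≤ Rg i (t i y) + 2 → ∃ hy' : y ∈ d.flatDomain, Ψ' i ⟨y, hy⟩ = Φ ⟨y, hy'⟩) ∧
    (∀ i, Tendsto (fun τ ↦ 𝓢.truncDeviationCk (B i) (Ψ' i) 2 (Rg i τ) τ) atTop (𝓝 0)) ∧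
    (∀ i, supCkENorm (Subtype.val '' {x : (B i).domain | τ₁ ≤ t i x.1 ∧ R₁ ≤ r i x.1 ∧
        r i x.1 ≤ Rg i (t i x.1) + 2}) 0 (𝓢.deviationExtend (B i) (Ψ' i)) ≤
      ENNReal.ofReal (1 / (10 * ‖(Λ i : E4 →L[ℝ] E4)‖ ^ 2))) ∧
    (∀ i (x : (B i).domain), τ₁ ≤ t i x.1 → R₁ ≤ r i x.1 → r i x.1 ≤ Rg i (t i x.1) + 2 →
      𝓢.timeOrientation.IsFutureDirected
        (mfderiv 𝓘(ℝ, E4) (𝓡 4) (Ψ' i) x ((Λ i) (E4.basisVector 0)))) ∧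
    -- A9: certified radii exhaust every fixed radius
    (∀ i, Tendsto (Rg i) atTop atTop) ∧
    -- A10: certified tubes (+2) of different holes are coordinate-disjoint at flat-late times
    (∀ j j' (y : E4), j ≠ j' → τ₁ ≤ y 0 → r j y ≤ Rg j (t j y) + 2 → Rg j' (t j' y) + 2 < r j' y) ∧
    -- A11: the re-gauged images of the extended late tubes are pairwise disjoint
    (∀ i j, i ≠ j → Disjoint (Ψ' i '' {x | τ₁ < t i x.1 ∧ r i x.1 < Rg i (t i x.1) + 2})
      (Ψ' j '' {x | τ₁ < t j x.1 ∧ r j x.1 < Rg j (t j x.1) + 2})) ∧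
    -- A12: late Ψ'-tube portions (any continuous profile below Rg + 2) are relatively closed in O
    (∀ i (τ' : ℝ) (ϱ : ℝ → ℝ), Continuous ϱ → τ₁ < τ' → (∀ s, ϱ s < Rg i s + 2) →
      closure (Ψ' i '' {x | τ' ≤ t i x.1 ∧ r i x.1 ≤ ϱ (t i x.1)}) ∩ O ⊆
        Ψ' i '' {x | τ' ≤ t i x.1 ∧ r i x.1 ≤ ϱ (t i x.1)}) ∧
    -- A13: the new atlas covers O causally, for every COMPATIBLE choice of late thresholds
    (∀ (T : ℝ) (Th : Fin d.N → ℝ), τ₁ < T → (∀ j, τ₁ < Th j) →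
      (∀ j (y : E4), T < y 0 → r j y ≤ Rg j (t j y) + 2 → Th j < t j y) →
      O \ (Φ '' {y | T < y.1 0 ∧ ∀ j, ρ' j (y.1 0) < r j y.1} ∪
          ⋃ j, Ψ' j '' {x | Th j < t j x.1 ∧ r j x.1 < Rg j (t j x.1) + 2}) ⊆
        𝓢.metric.causalPast 𝓢.timeOrientation
          (Φ '' {y | y.1 0 = T ∧ ∀ j, ρ' j (y.1 0) < r j y.1} ∪
            ⋃ j, Ψ' j '' {x | t j x.1 = Th j ∧ r j x.1 < Rg j (t j x.1) + 2}))

/-- `Seamed` = the crux's `Sm` (verbatim the `let`-bundle of `NecksCertifyR` / the landed seam). -/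
def Seamed (𝓢 : Spacetime.{0} 4) (O : Set 𝓢.carrier) (d : FinalStateDecomposition 𝓢 O 2)
    (R : Fin d.N → ℝ → ℝ) (R₀ : ℝ) : Prop :=
  let B := d.background; let t := fun i ↦ (B i).time; let r := fun i ↦ (B i).radius; let Λ := fun i ↦ ((d.motion i).1 : E4 ≃L[ℝ] E4); let Φ := d.flatChart; let Ψ := d.chart; let ρ := d.excision;
  (∀ i, Monotone (R i) ∧ Continuous (R i) ∧ ∀ s, R₀ + 4 ≤ R i s ∧ R₀ ≤ ρ i s) ∧
    (∀ i, Tendsto (fun τ ↦ 𝓢.truncDeviationCk (B i) (Ψ i) 2 (R i τ) τ) atTop (𝓝 0)) ∧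
    supCkENorm (Subtype.val '' {y : d.flatDomain | d.τ₀ ≤ y.1 0}) 0 (𝓢.deviationExtend (Minkowski.backgroundOn d.flatDomain) Φ) ≤ 10⁻¹ ∧
    (∀ i, supCkENorm (Subtype.val '' {x : (B i).domain | (d.τ₀ ≤ t i x.1 ∨ d.τ₀ ≤ x.1 0) ∧ R₀ ≤ r i x.1 ∧ r i x.1 ≤ R i (t i x.1)}) 0 (𝓢.deviationExtend (B i) (Ψ i)) ≤ ENNReal.ofReal (1 / (10 * ‖(Λ i : E4 →L[ℝ] E4)‖ ^ 2))) ∧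
    (∀ i (x : (B i).domain), (d.τ₀ ≤ t i x.1 ∨ d.τ₀ ≤ x.1 0) → R₀ ≤ r i x.1 → r i x.1 ≤ R i (t i x.1) → 𝓢.timeOrientation.IsFutureDirected (mfderiv 𝓘(ℝ, E4) (𝓡 4) (Ψ i) x ((Λ i) (E4.basisVector 0)))) ∧
    (∀ i (y : E4) (hy : y ∈ (B i).domain), d.τ₀ ≤ y 0 → (∀ j, ρ j (y 0) < r j y) → r i y ≤ R i (t i y) + 1 → ∃ hy' : y ∈ d.flatDomain, Ψ i ⟨y, hy⟩ = Φ ⟨y, hy'⟩) ∧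
    (∀ y : d.flatDomain, d.τ₀ ≤ y.1 0 → ∀ j, ρ j (y.1 0) < r j y.1) ∧
    (∀ j (y : E4), d.τ₀ ≤ y 0 → r j y ≤ ρ j (y 0) → r j y + 2 ≤ R j (t j y)) ∧
    (∀ j (y : E4), d.τ₀ ≤ t j y → r j y ≤ R j (t j y) + 2 → t j y ≤ y 0) ∧
    (∀ j, Ψ j '' {x | d.τ₀ < t j x.1 ∧ R j (t j x.1) + 1 < r j x.1} ⊆ d.radiationZone) ∧
    (∀ τ' : ℝ, d.τ₀ < τ' → closure (Φ '' {y | τ' ≤ y.1 0}) ⊆ Φ '' {y | τ' ≤ y.1 0} ∪ ⋃ j, Ψ j '' {x | τ' ≤ x.1 0 ∧ r j x.1 = ρ j (x.1 0)}) ∧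
    (∀ j j' (y : E4), j ≠ j' → (d.τ₀ ≤ y 0 ∨ d.τ₀ ≤ t j y) → r j y ≤ R j (t j y) + 1 → R j' (t j' y) + 1 < r j' y)

/-- **Certificate after relabelling, parity-safe form (v7).**  For every honest `C⁴` input with distinct
velocities, gap certificates above every sublinear eventual majorant at every hole, and at least one hole,
there is a `C⁴` decomposition `d'` of the SAME exterior with the SAME charted region and at least one hole —
obtained by un-permuting the labels (`LabelMatching`) and reflecting the orientation-mismatched hole charts
`(Λᵢ, Ψᵢ) ↦ (ΛᵢQᵢ, Ψᵢ ∘ Q̃ᵢ)` (landed `relabelEach`, H4) — which is core-honest, has relatively closed late flat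
tubes (`Hf`(2)), distinct velocities, and carries the v5 `NeckCertificate`.  (`Hf`(1) and `Hf`(3) are
deliberately NOT asserted: nothing downstream consumes them, and `Hf`(3) does not survive the reflection for
`d.N ≥ 2`.) -/
def WeakCertificateAfterRelabelling : Prop :=
  ∀ (X : Type) [TopologicalSpace X] [ChartedSpace E3 X] [IsManifold (𝓡 3) ∞ X] [ConnectedSpace X]
    (D : InitialDataSet (𝓡 3) X), D ∈ admissibleVacuumData X →
    ∀ 𝒟 : VacuumCauchyDevelopment D, 𝒟.IsMaximal →
    ∀ (O : Set 𝒟.carrier) (d : FinalStateDecomposition 𝒟.toSpacetime O 4) (R₀ : ℝ),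
      O = exteriorOf 𝒟.toCauchyDevelopment d.charted →
      HonestCore 𝒟.toSpacetime O 4 d R₀ → HonestFar 𝒟.toSpacetime O 4 d R₀ →
      DistinctVelocities 𝒟.toSpacetime O 4 d →
      (∀ (i : Fin d.N) (ρ' : ℝ → ℝ) (τm : ℝ), (∀ s, τm ≤ s → d.excision i s ≤ ρ' s) →
        Tendsto (fun s ↦ ρ' s / s) atTop (𝓝 0) →
        GapCertificateAt 𝒟.toSpacetime O d R₀ i (fun s ↦ 3 * ρ' s + 2)) →
      0 < d.N →
      ∃ (d' : FinalStateDecomposition 𝒟.toSpacetime O 4) (R₀' : ℝ),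
        d'.charted = d.charted ∧ 0 < d'.N ∧ HonestCore 𝒟.toSpacetime O 4 d' R₀' ∧
          FlatTubesClosed 𝒟.toSpacetime O 4 d' ∧ DistinctVelocities 𝒟.toSpacetime O 4 d' ∧
          NeckCertificate 𝒟.toSpacetime O d' R₀'

/-! ### S5 reduced (c1 wave-1 assembly worker; files `work/stubs/AssemblyDefs.lean`, `work/stubs/Assembly.lean`,
### KERNEL-CHECKED reduction `assembly_of_A_B_C`; shapes and sub-statements copied verbatim) -/

open Summit.FinalStateConjecture.FinalStateConjecture.Theorems.GapDecaySuffices.Relabel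
  (ParityDatum relabelMotion relabelChart relabelEach)

/-! ## Shapes shared by the three sub-statements -/

/-- G0–G5 of a gap certificate of hole `i` above `w`, for GIVEN data `(R₁, τ₁, W, Ψg)` (the body of
`GapCertificateAt` after its existential; `GapCertificateAt … w ↔ ∃ R₁ τ₁ W Ψg, GapCert … w R₁ τ₁ W Ψg`
is `Iff.rfl`). -/
def GapCert {𝓢 : Spacetime.{0} 4} {O : Set 𝓢.carrier} (d : FinalStateDecomposition 𝓢 O 4) (R₀ : ℝ)
    (i : Fin d.N) (w : ℝ → ℝ) (R₁ τ₁ : ℝ) (W : ℝ → ℝ) (Ψg : (d.background i).domain → 𝓢.carrier) : Prop :=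
  let B := d.background i; let t := B.time; let r := B.radius;
  R₀ ≤ R₁ ∧ d.τ₀ ≤ τ₁ ∧ Continuous W ∧ (∀ s, τ₁ ≤ s → w s ≤ W s) ∧
  (let U : Set B.domain := {x | τ₁ < t x.1 ∧ r x.1 < W (x.1 0) + 1};
    ContMDiffOn 𝓘(ℝ, E4) (𝓡 4) ∞ Ψg U ∧ Topology.IsOpenEmbedding (U.restrict Ψg) ∧ Ψg '' U ⊆ d.charted) ∧
  (∀ x : B.domain, r x.1 ≤ R₁ + 1 → Ψg x = d.chart i x) ∧
  Tendsto (fun τ ↦ supCkENorm (Subtype.val '' {x : B.domain | t x.1 = τ ∧ r x.1 ≤ W (x.1 0)}) 2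
    (𝓢.deviationExtend B Ψg)) atTop (𝓝 0) ∧
  (∀ x : B.domain, τ₁ ≤ t x.1 → R₁ ≤ r x.1 → r x.1 ≤ W (x.1 0) →
    𝓢.timeOrientation.IsFutureDirected
      (mfderiv 𝓘(ℝ, E4) (𝓡 4) Ψg x (((d.motion i).1 : E4 ≃L[ℝ] E4) (E4.basisVector 0)))) ∧
  (∀ (τ' : ℝ) (ϱ : ℝ → ℝ), Continuous ϱ → τ₁ < τ' →
    (∀ x : B.domain, τ' ≤ t x.1 → r x.1 ≤ ϱ (t x.1) → r x.1 ≤ W (x.1 0)) →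
    closure (Ψg '' {x | τ' ≤ t x.1 ∧ r x.1 ≤ ϱ (t x.1)}) ∩ O ⊆ Ψg '' {x | τ' ≤ t x.1 ∧ r x.1 ≤ ϱ (t x.1)})

/-- `GapCertificateAt` is `∃ data, GapCert data`. -/
theorem gapCertificateAt_iff {𝓢 : Spacetime.{0} 4} {O : Set 𝓢.carrier}
    (d : FinalStateDecomposition 𝓢 O 4) (R₀ : ℝ) (i : Fin d.N) (w : ℝ → ℝ) :
    GapCertificateAt 𝓢 O d R₀ i w ↔ ∃ (R₁ τ₁ : ℝ) (W : ℝ → ℝ)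
      (Ψg : (d.background i).domain → 𝓢.carrier), GapCert d R₀ i w R₁ τ₁ W Ψg :=
  Iff.rfl

/-- **Location of the flat collar `lo·ρ'(y⁰) ≤ rᵢ y ≤ hi·ρ'(y⁰)` in the gap chart** (the shape of S4's
conclusion, which is `∃ τ₂ κ, τ₁ ≤ τ₂ ∧ κ → 0 ∧ Located d i ρ' τ₁ W Ψg τ₂ κ (11/10) (29/10)`): after hole
time `τ₂` every such coordinate point is late-flat off every excised tube with margin `1`, and its flat
image is `Ψg x` for a gap-tube point `x` whose hole clock and radius are within `κ(tᵢ y)·ρ'(y⁰)` of `y`'s. -/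
def Located {𝓢 : Spacetime.{0} 4} {O : Set 𝓢.carrier} (d : FinalStateDecomposition 𝓢 O 4) (i : Fin d.N)
    (ρ' : ℝ → ℝ) (τ₁ : ℝ) (W : ℝ → ℝ) (Ψg : (d.background i).domain → 𝓢.carrier) (τ₂ : ℝ) (κ : ℝ → ℝ)
    (lo hi : ℝ) : Prop :=
  let B := d.background i; let t := B.time; let r := B.radius;
  ∀ (y : E4) (hy : y ∈ B.domain), τ₂ < t y → lo * ρ' (y 0) ≤ r y → r y ≤ hi * ρ' (y 0) →
    ∃ hy' : y ∈ d.flatDomain, d.τ₀ < y 0 ∧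
      (∀ j, d.excision j (y 0) + 1 ≤ (d.background j).radius y) ∧
      ∃ x : B.domain, τ₁ < t x.1 ∧ r x.1 < W (x.1 0) ∧ Ψg x = d.flatChart ⟨y, hy'⟩ ∧
        |t x.1 - t y| ≤ κ (t y) * ρ' (y 0) ∧ |r x.1 - r y| ≤ κ (t y) * ρ' (y 0)

/-- **Admissible analysis profile of hole `i`**: `ρ'` is smooth, non-decreasing, concave on `[0, ∞)`,
sublinear, unbounded, of slope `≤ 1/(4γᵢ)` (`γᵢ = (Λᵢ∂₀)⁰`, so that the hole-time profile `2ρ'(γᵢ t)`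
is `1`-Lipschitz), above the floor `R₀ + 2 + |aᵢ|` and `1`, and above `ρᵢ + 1` from `τm` on. -/
def AdmissibleProfile {𝓢 : Spacetime.{0} 4} {O : Set 𝓢.carrier} (d : FinalStateDecomposition 𝓢 O 4)
    (R₀ : ℝ) (i : Fin d.N) (ρ' : ℝ → ℝ) (τm : ℝ) : Prop :=
  ContDiff ℝ ∞ ρ' ∧ Monotone ρ' ∧ ConcaveOn ℝ (Set.Ici 0) ρ' ∧
    Tendsto (fun s ↦ ρ' s / s) atTop (𝓝 0) ∧ Tendsto ρ' atTop atTop ∧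
    (∀ s, 4 * ((d.motion i).1 : E4 ≃L[ℝ] E4) (E4.basisVector 0) 0 * |deriv ρ' s| ≤ 1) ∧
    (∀ s, R₀ + 2 + |d.spin i| ≤ ρ' s ∧ 1 ≤ ρ' s) ∧
    (∀ s, τm ≤ s → d.excision i s + 1 ≤ ρ' s)

/-- **Single-hole certificate of the `P`-relabelled hole `i`** — the clauses of `NeckCertificate` that
mention one hole only, for the relabelled label `(Λᵢ P.Q, cᵢ)` with hole chart `Ψᵢ ∘ Q̃` (=
`(relabelEach d P').background i`, `.chart i` definitionally whenever `P' i = P`), with `R₁ := R₀`,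
`ρa := ρ'`, late time `τn`, certified radius `Rc` and re-gauged chart `Ψa`: K1' `τ₀ ≤ τn`; K2 floor /
excision domination; K3' (`Rc` monotone, continuous, sublinear, `→ ∞`, `≥ R₀ + 4`); K3; K4 (smooth open
embedding of the late tube `U = {τn < t, r < Rc + 2}` into `d.charted`); K6 (`Ψa = Ψᵢ ∘ Q̃` inside
`R₀ + 1`); K7 (one atlas with the flat chart from `4ρ'` on); K8 (`C²` certification out to `Rc`); K9 (`C⁰`
honesty from `R₀`) and future `Λᵢ∂₀`-lines from `R₀`; K11 (relative closedness in `O` of the late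
sub-`Rc + 2` tube portions) — PLUS what the cross-hole bookkeeping needs and only the construction knows:
INNER LOCATION (every late point of the tube with `r ≤ 4ρ'(x⁰)` is mapped by `Ψa` to the `Ψg`-image of a
gap-tube point with clock and radius within `κ'(t)ρ'(x⁰)`, `κ' → 0`) and COVERAGE (`r < Rc(t) + 2` forces
`r ≤ 40ρ'(x⁰)`: the whole tube lies in the located range of the flat collar). -/
def SingleHoleCert {𝓢 : Spacetime.{0} 4} {O : Set 𝓢.carrier} (d : FinalStateDecomposition 𝓢 O 4)
    (R₀ : ℝ) (i : Fin d.N) (P : ParityDatum (d.motion i).1) (ρ' : ℝ → ℝ) (τ₁ : ℝ) (W : ℝ → ℝ)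
    (Ψg : (d.background i).domain → 𝓢.carrier) (τn : ℝ) (Rc κ' : ℝ → ℝ)
    (Ψa : (boostedKerrBackground (relabelMotion P) (d.motion i).2 (d.mass i) (d.spin i)).domain →
      𝓢.carrier) : Prop :=
  let B := boostedKerrBackground (relabelMotion P) (d.motion i).2 (d.mass i) (d.spin i)
  let t := B.time; let r := B.radius
  let Λ := ((relabelMotion P : lorentzGroup) : E4 ≃L[ℝ] E4)
  let Ψ := relabelChart P (d.motion i).2 (d.mass i) (d.spin i) (d.chart i)
  let Φ := d.flatChart; let ρ := d.excision i
  let t₀ := (d.background i).time; let r₀ := (d.background i).radius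
  d.τ₀ ≤ τn ∧ Tendsto κ' atTop (𝓝 0) ∧
  (∀ s, R₀ + 1 ≤ ρ' s ∧ (τn ≤ s → ρ s + 1 ≤ ρ' s)) ∧
  (Monotone Rc ∧ Continuous Rc ∧ Tendsto (fun s ↦ Rc s / s) atTop (𝓝 0) ∧
    Tendsto Rc atTop atTop ∧ ∀ s, R₀ + 4 ≤ Rc s) ∧
  (∀ y : E4, τn ≤ y 0 → r y ≤ 9 * ρ' (y 0) → r y + 3 ≤ Rc (t y)) ∧
  (let U : Set B.domain := {x | τn < t x.1 ∧ r x.1 < Rc (t x.1) + 2};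
    ContMDiffOn 𝓘(ℝ, E4) (𝓡 4) ∞ Ψa U ∧ IsOpenEmbedding (U.restrict Ψa) ∧ Ψa '' U ⊆ d.charted) ∧
  (∀ x : B.domain, r x.1 ≤ R₀ + 1 → Ψa x = Ψ x) ∧
  (∀ (y : E4) (hy : y ∈ B.domain), τn ≤ y 0 → 4 * ρ' (y 0) ≤ r y → r y ≤ Rc (t y) + 2 →
    ∃ hy' : y ∈ d.flatDomain, Ψa ⟨y, hy⟩ = Φ ⟨y, hy'⟩) ∧
  Tendsto (fun τ ↦ 𝓢.truncDeviationCk B Ψa 2 (Rc τ) τ) atTop (𝓝 0) ∧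
  supCkENorm (Subtype.val '' {x : B.domain | τn ≤ t x.1 ∧ R₀ ≤ r x.1 ∧ r x.1 ≤ Rc (t x.1) + 2}) 0
      (𝓢.deviationExtend B Ψa) ≤ ENNReal.ofReal (1 / (10 * ‖(Λ : E4 →L[ℝ] E4)‖ ^ 2)) ∧
  (∀ x : B.domain, τn ≤ t x.1 → R₀ ≤ r x.1 → r x.1 ≤ Rc (t x.1) + 2 →
    𝓢.timeOrientation.IsFutureDirected (mfderiv 𝓘(ℝ, E4) (𝓡 4) Ψa x (Λ (E4.basisVector 0)))) ∧
  (∀ (τ' : ℝ) (ϱ : ℝ → ℝ), Continuous ϱ → τn < τ' → (∀ s, ϱ s < Rc s + 2) →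
    closure (Ψa '' {x | τ' ≤ t x.1 ∧ r x.1 ≤ ϱ (t x.1)}) ∩ O ⊆
      Ψa '' {x | τ' ≤ t x.1 ∧ r x.1 ≤ ϱ (t x.1)}) ∧
  (∀ x : B.domain, τn < t x.1 → r x.1 ≤ 4 * ρ' (x.1 0) →
    ∃ x' : (d.background i).domain, τ₁ < t₀ x'.1 ∧ r₀ x'.1 < W (x'.1 0) ∧ Ψa x = Ψg x' ∧
      |t₀ x'.1 - t x.1| ≤ κ' (t x.1) * ρ' (x.1 0) ∧ |r₀ x'.1 - r x.1| ≤ κ' (t x.1) * ρ' (x.1 0)) ∧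
  (∀ x : B.domain, τn < t x.1 → r x.1 < Rc (t x.1) + 2 → r x.1 ≤ 40 * ρ' (x.1 0))

/-! ## The three sub-statements -/

/-- **(A) Per-hole re-gauge with parity decision.**  For a core- and far-honest `C⁴` decomposition with
distinct velocities, a hole `i`, an admissible profile `ρ'`, a gap certificate of hole `i` above the wall
`3·(16ρ') + 2` (S1 for the majorant `16ρ'`) and the location of the flat collar `[1.1ρ', 46ρ']` in it
(S4 iterated, `located_iterate`), there are a parity datum `P` of `Λᵢ` and data `(τn, Rc, κ', Ψa)`
certifying the `P`-RELABELLED hole (`SingleHoleCert`).  Intended proof (next wave): (1) `k := Ψg⁻¹ ∘ Φ`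
on the located collar is smooth with invertible differential (inverse function theorem on `𝒟.carrier`;
`DΨg`, `DΦ` are injective since the certified pullback metrics are non-degenerate), its Jacobian sign is
constant on the connected late collar: `P := oneDatum` if positive, `holeDatum` (H2, `det = −1`) if not,
so that the rest-frame transition `T = A⁻¹ k A ∘ Q` of the relabelled label has `det DT > 0`;
time-orientation `(DT∂₀)⁰ > 0` from `Hc`(4) + G4; (2) feed `SwitchOffInward` with hole-time profiles
`σ(t) = 2ρ'(γᵢt + cᵢ⁰)`, `rin` from `SlowSmoothMinorant`, `Bm` = rest-frame Kerr–Schild, `h₂` = cut-off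
rest-frame `Ψg`-deviation (G3), `h₁` = rest-frame flat deviation (flat `C⁴` certificate, tail sup), the
exact isometry identity being tautological; (3) `Ψa := Ψg_rest ∘ S ∘ A'⁻¹` on `{r < 3.4ρ'}`, `:= Φ` on
`{r > 3.1ρ'}` (they agree where `S = T`); K4 (local smoothness/openness, injectivity across the seam by
the two locations), K6, K7, inner location and coverage (`Rc(t) := 9ρ'(2γᵢt + C) + R₀ + 4`, clock bounds
`stub_flatTimeGe`), K8/K9 from G3 + the pullback conclusion + `FlatFarCertified`, future lines by continuity of the
time-orientation of the timelike fields `dΨa(Λ∂₀)` along connected slabs from the anchors `S = id` / G4 /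
`Hc`(4) (inward of `R₁`: near-zone smallness from G3), K11 from G5 (inner), compactness (middle, `S`
located) and `Hf`(2) (outer). -/
def PerHoleRegauge : Prop :=
  FlatFarCertified → SwitchOffInward →
  ∀ (𝓢 : Spacetime.{0} 4) (O : Set 𝓢.carrier) (d : FinalStateDecomposition 𝓢 O 4) (R₀ : ℝ) (i : Fin d.N)
    (ρ' : ℝ → ℝ) (τm R₁ τ₁ τ₂ : ℝ) (W κ : ℝ → ℝ) (Ψg : (d.background i).domain → 𝓢.carrier),
    HonestCore 𝓢 O 4 d R₀ → HonestFar 𝓢 O 4 d R₀ → DistinctVelocities 𝓢 O 4 d →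
    AdmissibleProfile d R₀ i ρ' τm →
    GapCert d R₀ i (fun s ↦ 3 * (16 * ρ' s) + 2) R₁ τ₁ W Ψg →
    τ₁ ≤ τ₂ → Tendsto κ atTop (𝓝 0) → Located d i ρ' τ₁ W Ψg τ₂ κ (11 / 10) 46 →
    ∃ (P : ParityDatum (d.motion i).1) (τn : ℝ) (Rc κ' : ℝ → ℝ)
      (Ψa : (boostedKerrBackground (relabelMotion P) (d.motion i).2 (d.mass i) (d.spin i)).domain →
        𝓢.carrier), SingleHoleCert d R₀ i P ρ' τ₁ W Ψg τn Rc κ' Ψa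

/-- **(B) Cross-hole bookkeeping.**  For an admissible datum, a maximal development, the exterior `O`, a
FULLY honest radius-anchored `C⁴` decomposition `d` (the output of label matching) with at least one hole,
parity data `P`, and per hole: an admissible profile, a located gap certificate and a single-hole
certificate of the `P i`-relabelled hole, the relabelled decomposition `relabelEach d P` carries the v5
`NeckCertificate` (with `R₁ := R₀`, `ρa i := ρ' i`, common `τ₁ := max τn` — every single-hole clause is
monotone in its late time).  To be PROVED: K10 — images of different holes' late tubes
`{τ₁ < tᵢ, rᵢ < Rcᵢ + 2}` are disjoint: outer parts are `Φ`-images of coordinate-disjoint late-flat sets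
(cone separation p106992, coverage `≤ 40ρ'ᵢ = o(t)`), inner parts are `Ψgᵢ`-images of sub-`5ρ'ᵢ` gap-tube
points (inner location); the mixed case "`Ψgᵢ(x) = Φ(y)`, `x` deep in hole `i`'s tube, `y` late-flat near
hole `j ≠ i`" is excluded by clopen continuation (coarse surjectivity `stub_clopenSurjection` of the
located transition on the shell `[1.2ρ'ᵢ, 45ρ'ᵢ]`, relative closedness G5 / `Hf`(2), connectedness of the
late far-flat region) — NOT by the structure's fixed-radius `exists_pairwise_disjoint`; K12 — causal
covering of `O` beyond `5ρ'` and the `Ψa`-tubes for every compatible threshold choice: the structure's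
covering clause + `Hc`(2) (hole discs) + `Hf`(1) (flat slabs) + future `Λⱼ∂₀`-flows inside certified tubes
(future-lines clause of the single-hole certificates) + exit arguments in the style of the landed `N = 0` certificate
(`…NecksCertifyStubNeckLedgerAnalysisZero`) and `…SeamedChartsExhaust*`, global hyperbolicity of the MGHD.
If either turned out not to follow for some honest input, that would be a misstatement of the crux's
hinge, to be reported with the configuration. -/
def CertificateBookkeeping : Prop :=
  ∀ (X : Type) [TopologicalSpace X] [ChartedSpace E3 X] [IsManifold (𝓡 3) ∞ X] [ConnectedSpace X]
    (D : InitialDataSet (𝓡 3) X), D ∈ admissibleVacuumData X →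
    ∀ 𝒟 : VacuumCauchyDevelopment D, 𝒟.IsMaximal →
    ∀ (O : Set 𝒟.carrier) (d : FinalStateDecomposition 𝒟.toSpacetime O 4) (R₀ : ℝ),
      O = exteriorOf 𝒟.toCauchyDevelopment d.charted →
      HonestCore 𝒟.toSpacetime O 4 d R₀ → HonestFar 𝒟.toSpacetime O 4 d R₀ →
      DistinctVelocities 𝒟.toSpacetime O 4 d → TubeAnchoredR d R₀ → 0 < d.N →
      ∀ (P : ∀ i, ParityDatum (d.motion i).1) (ρ' : Fin d.N → ℝ → ℝ) (τm R₁ τ₁ τ₂ τn : Fin d.N → ℝ)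
        (W κ Rc κ' : Fin d.N → ℝ → ℝ) (Ψg : ∀ i, (d.background i).domain → 𝒟.carrier)
        (Ψa : ∀ i, (boostedKerrBackground (relabelMotion (P i)) (d.motion i).2 (d.mass i)
          (d.spin i)).domain → 𝒟.carrier),
        (∀ i, AdmissibleProfile d R₀ i (ρ' i) (τm i)) →
        (∀ i, GapCert d R₀ i (fun s ↦ 3 * (16 * ρ' i s) + 2) (R₁ i) (τ₁ i) (W i) (Ψg i)) →
        (∀ i, τ₁ i ≤ τ₂ i ∧ Tendsto (κ i) atTop (𝓝 0) ∧
          Located d i (ρ' i) (τ₁ i) (W i) (Ψg i) (τ₂ i) (κ i) (11 / 10) 46) →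
        (∀ i, SingleHoleCert d R₀ i (P i) (ρ' i) (τ₁ i) (W i) (Ψg i) (τn i) (Rc i) (κ' i) (Ψa i)) →
        NeckCertificate 𝒟.toSpacetime O (relabelEach d P) R₀

/-- **(C) Concave dominator** (one real variable, Mathlib-level): every function `f` with `f(s)/s → 0`
at `+∞` is dominated IN RATIO (`f/ρ → 0`) by a smooth, non-decreasing profile `ρ`, concave on `[0, ∞)`,
sublinear, unbounded, above any prescribed floor `b` and of slope at most any prescribed `ε > 0`.
PROVED (`concaveDominator`, file `…StubAssemblyConcaveDominator.lean`: mollified concave polygon envelope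
`⨅ₙ (ε s/(n+1) + cₙ)` of a monotone sublinear majorant of `|f|`). -/
def ConcaveDominator : Prop :=
  ∀ (f : ℝ → ℝ) (b ε : ℝ), Tendsto (fun s ↦ f s / s) atTop (𝓝 0) → 0 < ε →
    ∃ ρ : ℝ → ℝ, ContDiff ℝ ∞ ρ ∧ Monotone ρ ∧ ConcaveOn ℝ (Set.Ici 0) ρ ∧
      Tendsto (fun s ↦ ρ s / s) atTop (𝓝 0) ∧ Tendsto ρ atTop atTop ∧
      (∀ s, b ≤ ρ s) ∧ (∀ s, |deriv ρ s| ≤ ε) ∧ Tendsto (fun s ↦ f s / ρ s) atTop (𝓝 0)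

/-- Registered stub S5-A (per-hole re-gauge with parity decision; XL, the geometric construction). -/
theorem stub_perHoleRegauge : PerHoleRegauge := by
  sorry

/-- Registered stub S5-B (cross-hole bookkeeping K10/K12 + synchronisation; XL, the causal/topological part —
K10 at growing radii is NOT supplied by the structure). -/
theorem stub_certificateBookkeeping : CertificateBookkeeping := by
  sorry

/-- Brick S5-C `ConcaveDominator` — PROVED by the wave-1 assembly worker (`concaveDominator`, proposal p166564,
`Theorems/StarvedNecksGapDecaySufficesStubAssemblyConcaveDominator.lean`, ACCEPTED). -/
theorem concaveDominator' : ConcaveDominator :=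
  Theorems.GapDecaySuffices.Assembly.concaveDominator

/-- Registered reduction header S5 (KERNEL-CHECKED by the wave-1 worker in `work/stubs/Assembly.lean` as
`…Theorems.GapDecaySuffices.Assembly.assembly_of_A_B_C`, against `AnchoredLocation`/`LabelMatchingN`; v8 asks the
same with `AnchoredLocationP` and the v8 `LabelMatching` — the non-negativity clause of LM discharges S4's new
hypothesis — LANDED p168243, with AssemblyDefs p167524). -/
theorem assembly_of_A_B_C : PerHoleRegauge → CertificateBookkeeping → ConcaveDominator →
    (GapBootstrap → FlatFarCertified → SwitchOffInward → AnchoredLocationP → LabelMatching →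
      WeakCertificateAfterRelabelling) :=
  Theorems.GapDecaySuffices.Assembly.assembly_of_A_B_C

/-- Stub S5 `stub_assembly` (v8 signature), DERIVED from A, B, C through the reduction header. -/
theorem stub_assembly :
    GapBootstrap → FlatFarCertified → SwitchOffInward → AnchoredLocationP → LabelMatching →
      WeakCertificateAfterRelabelling :=
  assembly_of_A_B_C stub_perHoleRegauge stub_certificateBookkeeping concaveDominator'

/-- **Chart surgery, core form** = the landed `…Bookkeeping.stub_chartSurgery` (p107332) WITHOUT its unused
`HonestFar` binder (the landed proof binds it as `_hf` and destructs `Hc` as `⟨hc1, -, -, -⟩`): the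
`NeckCertificate` of a core-honest `C⁴` decomposition with cone-separated label lines yields the `NeckAtlas`.
Mechanical copy of the landed proof. -/
def ChartSurgeryCore : Prop :=
  ∀ (X : Type) [TopologicalSpace X] [ChartedSpace E3 X] [IsManifold (𝓡 3) ∞ X] [ConnectedSpace X]
    (D : InitialDataSet (𝓡 3) X), D ∈ admissibleVacuumData X →
    ∀ 𝒟 : VacuumCauchyDevelopment D, 𝒟.IsMaximal →
    ∀ (O : Set 𝒟.carrier) (d : FinalStateDecomposition 𝒟.toSpacetime O 4) (R₀ : ℝ),
      O = exteriorOf 𝒟.toCauchyDevelopment d.charted →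
      HonestCore 𝒟.toSpacetime O 4 d R₀ →
      NeckCertificate 𝒟.toSpacetime O d R₀ →
      ConeSeparated 𝒟.toSpacetime O 4 d →
      NeckAtlas 𝒟.toSpacetime O d R₀

/-- Registered stub (v7, mechanical): `ChartSurgeryCore` — LANDED p164628 (wave 1). -/
theorem stub_chartSurgeryCore : ChartSurgeryCore :=
  Theorems.GapDecaySuffices.ChartSurgeryCore.stub_chartSurgeryCore

/-- **Seam surgery for `0 < d.N`, `Hf`(2)-only form** = the `0 < d.N` branch of the landed
`…Seam.stub_seamSurgery` (p94437; it destructs `Hc` as `⟨hc1, hc2, -, hc4⟩` and `Hf` as `⟨-, hf2, -⟩`), with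
its two antecedents `SeamClockRadii`, `SeamFlatRestrict` discharged by the landed
`…ClockRadii.stub_seamClockRadii` / `…FlatRestrict.stub_seamFlatRestrict`: a core-honest `C⁴` decomposition
with relatively closed late flat tubes, at least one hole and a `NeckAtlas` re-seams into a `C²` decomposition
of the same exterior which is core-honest and `Seamed`.  Mechanical copy of the landed proof. -/
def SeamSurgeryPos : Prop :=
  ∀ (X : Type) [TopologicalSpace X] [ChartedSpace E3 X] [IsManifold (𝓡 3) ∞ X] [ConnectedSpace X]
    (D : InitialDataSet (𝓡 3) X), D ∈ admissibleVacuumData X →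
    ∀ 𝒟 : VacuumCauchyDevelopment D, 𝒟.IsMaximal →
    ∀ (O : Set 𝒟.carrier) (d : FinalStateDecomposition 𝒟.toSpacetime O 4) (R₀ : ℝ),
      O = exteriorOf 𝒟.toCauchyDevelopment d.charted →
      HonestCore 𝒟.toSpacetime O 4 d R₀ → FlatTubesClosed 𝒟.toSpacetime O 4 d → 0 < d.N →
      NeckAtlas 𝒟.toSpacetime O d R₀ →
      ∃ (d₂ : FinalStateDecomposition 𝒟.toSpacetime O 2) (R : Fin d₂.N → ℝ → ℝ) (R₀' : ℝ),
        O = exteriorOf 𝒟.toCauchyDevelopment d₂.charted ∧ HonestCore 𝒟.toSpacetime O 2 d₂ R₀' ∧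
          Seamed 𝒟.toSpacetime O d₂ R R₀'

/-- Registered stub (v7, mechanical): `SeamSurgeryPos` — LANDED p164565 (wave 1). -/
theorem stub_seamSurgeryPos : SeamSurgeryPos :=
  Theorems.GapDecaySuffices.SeamSurgeryPos.stub_seamSurgeryPos

/-! ## Registered bricks (reusable lemmas the stubs above consume) — ALL LANDED: p138641
(`…StubClopenSurjection.lean`), p138651 (`…StubCollarLateFlat.lean`) -/

/-- **Clopen surjection** (coarse surjectivity without degree theory): a map continuous on `U`, open on
`U`, whose `U`-preimages of a preconnected `W` stay in a compact `K ⊆ U`, and which hits `W` once,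
covers `W`.  Used to LOCATE chart images (S4, S5: all charts are open embeddings). -/
theorem stub_clopenSurjection {E F : Type*} [TopologicalSpace E]
    [FirstCountableTopology E] [TopologicalSpace F] [T2Space F] [FirstCountableTopology F]
    {h : E → F} {U : Set E} {K : Set E} {W : Set F}
    (hcont : ContinuousOn h U) (hopen : IsOpenMap (U.restrict h))
    (hW : IsPreconnected W) (hK : IsCompact K) (hKU : K ⊆ U)
    (hpre : ∀ x ∈ U, h x ∈ W → x ∈ K) (hseed : ∃ x ∈ U, h x ∈ W) :
    W ⊆ h '' U :=
  Theorems.GapDecaySuffices.Location.stub_clopenSurjection hcont hopen hW hK hKU hpre hseed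

/-- **Coarse surjectivity of a located open map on a ball**: continuous on the closed ball, open on the
open ball, displacement `≤ κ`, `2κ < R` ⇒ the image of the open ball contains `ball c (R − 2κ)`. -/
theorem stub_ballSubsetImage {E : Type*} [NormedAddCommGroup E]
    [NormedSpace ℝ E] [FiniteDimensional ℝ E] {h : E → E} {c : E} {R κ : ℝ}
    (hcont : ContinuousOn h (Metric.closedBall c R)) (hopen : IsOpenMap ((Metric.ball c R).restrict h))
    (hdisp : ∀ x ∈ Metric.closedBall c R, ‖h x - x‖ ≤ κ) (hκ : 0 ≤ κ) (hR : 2 * κ < R) :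
    Metric.ball c (R - 2 * κ) ⊆ h '' Metric.ball c R :=
  Theorems.GapDecaySuffices.Location.stub_ballSubsetImage hcont hopen hdisp hκ hR

/-- **Lower Lorentz clock bound** on a boosted Kerr background (brick, wave-1 worker; file
`work/stubs/StubAnchoredLocation.lean`): `c⁰ + γ·t(y) − √(γ² − 1)(r(y) + |a|) ≤ y⁰`. -/
theorem stub_flatTimeGe (Λ : lorentzGroup) (c : E4) (M a : ℝ) (y : E4) :
    c 0 + ((Λ : E4 ≃L[ℝ] E4) (E4.basisVector 0)) 0 * (boostedKerrBackground Λ c M a).time y -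
      Real.sqrt ((((Λ : E4 ≃L[ℝ] E4) (E4.basisVector 0)) 0) ^ 2 - 1) *
        ((boostedKerrBackground Λ c M a).radius y + |a|) ≤ y 0 :=
  Theorems.GapDecaySuffices.Location.stub_flatTimeGe Λ c M a y

/-- **Late collars are late-flat** (brick, wave-1 worker; first half of S4's conclusion): for a
monotone sublinear `ρ' ≥ 1` with `ρᵢ + 1 ≤ a₀ρ'` eventually, late collar points
`a₀ρ'(y⁰) ≤ rᵢ y ≤ Aρ'(y⁰)`, `tᵢ y > τ₂`, lie in the flat domain with `τ₀ < y⁰` and clear every excised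
tube with margin 1 (cone separation p106992 + clock bound + sublinearity). -/
theorem stub_collarLateFlat {𝓢 : Spacetime.{0} 4} {O : Set 𝓢.carrier} {k : ℕ}
    (d : FinalStateDecomposition 𝓢 O k)
    (horth : ∀ j, 0 < ((d.motion j).1 : E4 ≃L[ℝ] E4) (E4.basisVector 0) 0)
    (hdv : ∀ i j : Fin d.N, i ≠ j →
      ((d.motion i).1 : E4 ≃L[ℝ] E4) (E4.basisVector 0) ≠
        ((d.motion j).1 : E4 ≃L[ℝ] E4) (E4.basisVector 0))
    (i : Fin d.N) {ρ' : ℝ → ℝ} (hmono : Monotone ρ') (hone : ∀ s, 1 ≤ ρ' s)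
    (hsub : Tendsto (fun s ↦ ρ' s / s) atTop (𝓝 0)) (a₀ A : ℝ)
    (hexc : ∀ᶠ s in atTop, d.excision i s + 1 ≤ a₀ * ρ' s) (τ₁ : ℝ) :
    ∃ τ₂ : ℝ, τ₁ ≤ τ₂ ∧ ∀ y : E4, τ₂ < (d.background i).time y →
      a₀ * ρ' (y 0) ≤ (d.background i).radius y → (d.background i).radius y ≤ A * ρ' (y 0) →
      y ∈ d.flatDomain ∧ d.τ₀ < y 0 ∧ ∀ j, d.excision j (y 0) + 1 ≤ (d.background j).radius y :=
  Theorems.GapDecaySuffices.Location.stub_collarLateFlat d horth hdv i hmono hone hsub a₀ A hexc τ₁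

/-! ## Registered bricks, open (attackable now, Mathlib-level) -/

/-- **Quantitative Alexandrov–Zeeman on a ball (frame-free zeroth-order rigidity, Minkowskian core).**
There are universal `C, δ* > 0` such that: if a map `k : E4 → E4` preserves the Minkowski interval of
every UNIFORMLY TIMELIKE pair of points of the Euclidean ball `B(x₀, 20ℓ)` up to the relative error
`δ ≤ δ*` — `|η(kz − ky, kz − ky) − η(z − y, z − y)| ≤ δ·|η(z − y, z − y)|` whenever
`η(z − y, z − y) ≤ −¼‖z − y‖²` — then on the concentric ball `B(x₀, ℓ)` it is `Cδℓ`-close to a Poincaré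
AFFINE map `y ↦ A y + c` whose linear part is `Cδ`-approximately Lorentz, the error being measured in
the DOMAIN frame (`k y = A (y + e) + c`, `‖e‖ ≤ Cδℓ`), so that no bound on `A` or on `Dk` is needed or
asserted (an exact Lorentz matrix within `O(δ)` of `A` then comes from Lorentzian Gram–Schmidt, not
needed by the consumers).  (Chronological simplex in the past of the small ball, Gram data from
intervals, trilateration = a linear solve.) -/
def QuantAlexandrovZeeman : Prop :=
  ∃ C δs : ℝ, 0 < C ∧ 0 < δs ∧
    ∀ (δ ℓ : ℝ) (x₀ : E4) (k : E4 → E4), 0 < δ → δ ≤ δs → 0 < ℓ →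
      (∀ y ∈ Metric.ball x₀ (20 * ℓ), ∀ z ∈ Metric.ball x₀ (20 * ℓ),
        Minkowski.bilin (z - y) (z - y) ≤ -(1 / 4) * ‖z - y‖ ^ 2 →
        |Minkowski.bilin (k z - k y) (k z - k y) - Minkowski.bilin (z - y) (z - y)| ≤
          δ * |Minkowski.bilin (z - y) (z - y)|) →
      ∃ (A : E4 →L[ℝ] E4) (c : E4),
        (∀ v w : E4, |Minkowski.bilin (A v) (A w) - Minkowski.bilin v w| ≤ C * δ * ‖v‖ * ‖w‖) ∧
        ∀ y ∈ Metric.ball x₀ ℓ, ∃ e : E4, ‖e‖ ≤ C * δ * ℓ ∧ k y = A (y + e) + c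


/-- Registered brick `QuantAlexandrovZeeman` — LANDED (Literature p141093 `MinkowskiSimplexFit` + p144407
`QuantitativeAlexandrovZeeman` → `MinkowskiSimplex.quantAlexandrovZeeman_ball`; Theorems stub p146030): the Minkowskian core
of frame-free zeroth-order rigidity, consumed by S4′ (coarse location of `Ψg⁻¹ ∘ Φ`) and by S3's strategy (§7). -/
theorem stub_quantAlexandrovZeeman : QuantAlexandrovZeeman :=
  Theorems.GapDecaySuffices.QAZ.stub_quantAlexandrovZeeman

/-- Registered brick (lead c1, wave 1; statement = the landed `def`
`…Theorems.GapDecaySuffices.Location.AnchoredV2.OneSidedIntervalComparison` of p145261, Mathlib-level, M):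
the ONE-SIDED INTERVAL COMPARISON for an exact isometry `k` between `η + h₁` and `η + h₂` with an a-priori
operator bound `‖Dk‖ ≤ Γ` — `k`-images of uniformly timelike pairs keep at least `(1 − Cε)` of their interval
(reverse Minkowski inequality along the image of the segment).  Consumed by S4′ (`SeededLocation`, tame scales). -/
theorem stub_oneSidedIntervalComparison :
    Theorems.GapDecaySuffices.Location.AnchoredV2.OneSidedIntervalComparison :=
  Theorems.GapDecaySuffices.Location.IntervalComparison.stub_oneSidedIntervalComparison

/-! ## Registered bricks, wave 2 — S4 entry/rays bricks LANDED (p143739 `…StubAnchoredEntry.lean`, p144058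
`…StubAnchoredRays.lean`); S5 parity-relabel bricks H1–H4 registered, files 1/4 pending (p144389), bodies `sorry`
until their Theorems files land -/

/-- Registered brick (wave 2, S4 worker; file `work/stubs/StubAnchoredEntry.lean` → `Theorems/StarvedNecksGapDecaySufficesStubAnchoredEntry.lean`): ENTRY BY CLOPEN CONTINUATION with an a-priori bootstrap — along a preconnected parameter set `K`, the set of parameters whose target point `φ k` has an `h`-preimage in `U` satisfying the open condition `V` and the closed condition `C` is all of `K`, given openness of `h` on `U`, relative closedness of `h(A)` in `O ∋ φ(K)`, the bootstrap `V ⇒ A`, `V ⇒ C` on preimages, the clearance `C ⇒ V` on `A`, and one seed. -/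
theorem entry_bootstrap {E P F : Type*} [TopologicalSpace E] [TopologicalSpace P]
    [TopologicalSpace F] {h : E → F} {U A : Set E} {O : Set F} {φ : P → F} {K : Set P}
    {V C : Set (E × P)}
    (hemb : IsOpenEmbedding (U.restrict h)) (hAU : A ⊆ U)
    (hclos : closure (h '' A) ∩ O ⊆ h '' A)
    (hK : IsPreconnected K) (hφ : ContinuousOn φ K) (hKO : ∀ k ∈ K, φ k ∈ O)
    (hV : IsOpen V) (hC : IsClosed C)
    (hVA : ∀ k ∈ K, ∀ x ∈ U, h x = φ k → (x, k) ∈ V → x ∈ A)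
    (himp : ∀ k ∈ K, ∀ x ∈ U, h x = φ k → (x, k) ∈ V → (x, k) ∈ C)
    (hclear : ∀ k ∈ K, ∀ x ∈ A, h x = φ k → (x, k) ∈ C → (x, k) ∈ V)
    (hseed : ∃ k ∈ K, ∃ x ∈ U, h x = φ k ∧ (x, k) ∈ V) :
    ∀ k ∈ K, ∃ x ∈ U, h x = φ k ∧ (x, k) ∈ V ∧ (x, k) ∈ C :=
  Theorems.GapDecaySuffices.Location.entry_bootstrap hemb hAU hclos hK hφ hKO hV hC hVA himp hclear hseed

/-- Registered brick (wave 2, S4 worker; same file): entry of a preconnected late flat set into the gap tube `{τ' < tᵢ, rᵢ < ϱ(tᵢ)}` of a gap chart `Ψg` (G1 open embedding, G5 relative closedness verbatim), given no rim contact and one seed. -/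
theorem flat_entry_gapTube {𝓢 : Spacetime.{0} 4} {O : Set 𝓢.carrier} {k : ℕ}
    (d : FinalStateDecomposition 𝓢 O k) (i : Fin d.N) {τ₁ τ' : ℝ}
    {W ϱ : ℝ → ℝ} {Ψg : (d.background i).domain → 𝓢.carrier}
    (hemb : IsOpenEmbedding ({x : (d.background i).domain | τ₁ < (d.background i).time x.1 ∧
        (d.background i).radius x.1 < W (x.1 0) + 1}.restrict Ψg))
    (hclos : closure (Ψg '' {x | τ' ≤ (d.background i).time x.1 ∧
        (d.background i).radius x.1 ≤ ϱ ((d.background i).time x.1)}) ∩ O ⊆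
      Ψg '' {x | τ' ≤ (d.background i).time x.1 ∧
        (d.background i).radius x.1 ≤ ϱ ((d.background i).time x.1)})
    (hϱ : Continuous ϱ) (hτ : τ₁ < τ')
    (hϱW : ∀ x : (d.background i).domain, τ' ≤ (d.background i).time x.1 →
      (d.background i).radius x.1 ≤ ϱ ((d.background i).time x.1) →
      (d.background i).radius x.1 ≤ W (x.1 0))
    {S : Set E4} (hS : IsPreconnected S) (hSf : S ⊆ d.flatDomain) (hlate : ∀ y ∈ S, d.τ₀ < y 0)
    (hrim : ∀ y (hy : y ∈ S), ∀ x : (d.background i).domain, τ' ≤ (d.background i).time x.1 →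
      (d.background i).radius x.1 ≤ ϱ ((d.background i).time x.1) →
      Ψg x = d.flatChart ⟨y, hSf hy⟩ →
      τ' < (d.background i).time x.1 ∧
        (d.background i).radius x.1 < ϱ ((d.background i).time x.1))
    (hseed : ∃ (y : E4) (hy : y ∈ S) (x : (d.background i).domain),
      τ' < (d.background i).time x.1 ∧
        (d.background i).radius x.1 < ϱ ((d.background i).time x.1) ∧
        Ψg x = d.flatChart ⟨y, hSf hy⟩) :
    ∀ y (hy : y ∈ S), ∃ x : (d.background i).domain, τ' < (d.background i).time x.1 ∧
      (d.background i).radius x.1 < ϱ ((d.background i).time x.1) ∧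
      Ψg x = d.flatChart ⟨y, hSf hy⟩ :=
  Theorems.GapDecaySuffices.Location.flat_entry_gapTube d i hemb hclos hϱ hτ hϱW hS hSf hlate hrim hseed

/-- Registered brick (wave 2, S4 worker; file `work/stubs/StubAnchoredRays.lean` → `Theorems/StarvedNecksGapDecaySufficesStubAnchoredRays.lean`): preconnected constant-lab-time inward rays in a boosted Kerr exterior reaching any radius `r₀ > max r₊ 0` below that of the starting point, radius monotone along the ray. -/
theorem exists_ray_constLabTime (Λ : lorentzGroup) (c : E4) (M a : ℝ)
    (hv : 0 < ((Λ : E4 ≃L[ℝ] E4) (E4.basisVector 0)) 0) (y : E4) {r₀ : ℝ}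
    (hr₀ : max (Kerr.rPlus M a) 0 < r₀) (hr₀y : r₀ ≤ (boostedKerrBackground Λ c M a).radius y) :
    ∃ S : Set E4, IsPreconnected S ∧ y ∈ S ∧
      S ⊆ ((boostedKerrBackground Λ c M a).domain : Set E4) ∧
      (∀ z ∈ S, z 0 = y 0 ∧ r₀ ≤ (boostedKerrBackground Λ c M a).radius z ∧
        (boostedKerrBackground Λ c M a).radius z ≤ (boostedKerrBackground Λ c M a).radius y) ∧
      ∃ z ∈ S, (boostedKerrBackground Λ c M a).radius z = r₀ :=
  Theorems.GapDecaySuffices.Location.exists_ray_constLabTime Λ c M a hv y hr₀ hr₀y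

/-- Registered brick (wave 2, S5 worker, H1; file `work/stubs/RelabelPullbackNorms.lean` → `Theorems/StarvedNecksGapDecaySufficesRelabelPullbackNorms.lean`): `Cᵏ` sup norms of fields of bilinear forms are invariant under affine Euclidean isometries. -/
theorem stub_supCkENormPullbackAffine {E : Type*} [NormedAddCommGroup E] [NormedSpace ℝ E]
    (L : E ≃ₗᵢ[ℝ] E) (c c' : E) (θ : E → E) (hθ : ∀ x, θ x = c + L (x - c')) (S : Set E) (k : ℕ)
    (F : E → E →L[ℝ] E →L[ℝ] ℝ) :
    supCkENorm S k (bilinPullback θ F) = supCkENorm (θ '' S) k F :=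
  Theorems.GapDecaySuffices.Relabel.stub_supCkENormPullbackAffine L c c' θ hθ S k F

/-- Registered brick (wave 2, H2; `work/stubs/RelabelReflection.lean` → `…RelabelReflection.lean`): the parity datum of a label — a Euclidean-isometric Lorentz involution `Q` fixing `∂₀`, `Λ⁻¹∂₀`, `x³` with `det Q = −1`. -/
theorem stub_parityReflection (Λ : lorentzGroup) :
    ∃ Q : lorentzGroup, (∀ v, (Q : E4 ≃L[ℝ] E4) ((Q : E4 ≃L[ℝ] E4) v) = v) ∧
      (Q : E4 ≃L[ℝ] E4) (E4.basisVector 0) = E4.basisVector 0 ∧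
      (Q : E4 ≃L[ℝ] E4) ((Λ : E4 ≃L[ℝ] E4).symm (E4.basisVector 0)) =
        (Λ : E4 ≃L[ℝ] E4).symm (E4.basisVector 0) ∧
      (∀ v, (Q : E4 ≃L[ℝ] E4) v 3 = v 3) ∧ (∀ v, ‖(Q : E4 ≃L[ℝ] E4) v‖ = ‖v‖) ∧
      LinearMap.det ((Q : E4 ≃L[ℝ] E4) : E4 →ₗ[ℝ] E4) = -1 :=
  Theorems.GapDecaySuffices.Relabel.stub_parityReflection Λ

/-- Registered brick (wave 2, H3; `work/stubs/RelabelChartTransfer.lean` → `…RelabelChartTransfer.lean`): the zero-extended deviation of the reflected chart `Ψ ∘ Q̃` is the pullback of that of `Ψ` along `Q̃`. -/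
theorem stub_deviationExtendParity {𝓢 : Spacetime.{0} 4} (Λ Q : lorentzGroup) (c : E4) (M a : ℝ)
    (hQQ : ∀ v, (Q : E4 ≃L[ℝ] E4) ((Q : E4 ≃L[ℝ] E4) v) = v)
    (hQ0 : (Q : E4 ≃L[ℝ] E4) (E4.basisVector 0) = E4.basisVector 0)
    (hQu : (Q : E4 ≃L[ℝ] E4) ((Λ : E4 ≃L[ℝ] E4).symm (E4.basisVector 0)) =
      (Λ : E4 ≃L[ℝ] E4).symm (E4.basisVector 0))
    (hQ3 : ∀ v, (Q : E4 ≃L[ℝ] E4) v 3 = v 3)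
    (θ : (boostedKerrBackground (Λ * Q) c M a).domain → (boostedKerrBackground Λ c M a).domain)
    (hθ : ∀ x, (θ x).1 = c + ((Λ * Q * Λ⁻¹ : lorentzGroup) : E4 ≃L[ℝ] E4) (x.1 - c))
    (Ψ : (boostedKerrBackground Λ c M a).domain → 𝓢.carrier) (hΨ : ContMDiff 𝓘(ℝ, E4) (𝓡 4) ∞ Ψ) :
    𝓢.deviationExtend (boostedKerrBackground (Λ * Q) c M a) (Ψ ∘ θ) =
      bilinPullback (fun x ↦ c + ((Λ * Q * Λ⁻¹ : lorentzGroup) : E4 ≃L[ℝ] E4) (x - c))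
        (𝓢.deviationExtend (boostedKerrBackground Λ c M a) Ψ) :=
  Theorems.GapDecaySuffices.Relabel.stub_deviationExtendParity Λ Q c M a hQQ hQ0 hQu hQ3 θ hθ Ψ hΨ

/-- Registered brick (wave 2, H4; `work/stubs/RelabelEach.lean` → `…RelabelEach.lean`): the per-label parity-relabelled decomposition `relabelEach d Q` — same charted set, flat domain, `τ₀`, flat chart; `Hc` and distinct labels transfer; chart images of `(t, r, x⁰)`-defined sets unchanged.  CAVEAT (worker, kernel-level finding): `Hf`(3) does NOT transfer for `d.N ≥ 2` (the honest cell `{R₀ ≤ rᵢ ≤ rⱼ}` is not `Q̃ᵢ`-invariant), only for `d.N = 1`. -/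
theorem stub_parityRelabelDecomposition {𝓢 : Spacetime.{0} 4} {O : Set 𝓢.carrier} {k : ℕ}
    (d : FinalStateDecomposition 𝓢 O k) (R₀ : ℝ) (Q : Fin d.N → lorentzGroup)
    (hQQ : ∀ i v, (Q i : E4 ≃L[ℝ] E4) ((Q i : E4 ≃L[ℝ] E4) v) = v)
    (hQ0 : ∀ i, (Q i : E4 ≃L[ℝ] E4) (E4.basisVector 0) = E4.basisVector 0)
    (hQu : ∀ i, (Q i : E4 ≃L[ℝ] E4) (((d.motion i).1 : E4 ≃L[ℝ] E4).symm (E4.basisVector 0)) =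
      ((d.motion i).1 : E4 ≃L[ℝ] E4).symm (E4.basisVector 0))
    (hQ3 : ∀ i v, (Q i : E4 ≃L[ℝ] E4) v 3 = v 3)
    (hc : Theorems.GapDecaySuffices.Negative.Relabel.HonestCoreOf d R₀)
    (hdv : Theorems.GapDecaySuffices.Negative.Relabel.DistinctLabels d) :
    ∃ d' : FinalStateDecomposition 𝓢 O k, d'.charted = d.charted ∧ d'.flatDomain = d.flatDomain ∧
      d'.τ₀ = d.τ₀ ∧
      (∀ (y : E4) (hy : y ∈ d.flatDomain) (hy' : y ∈ d'.flatDomain), d'.flatChart ⟨y, hy'⟩ = d.flatChart ⟨y, hy⟩) ∧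
      Theorems.GapDecaySuffices.Negative.Relabel.HonestCoreOf d' R₀ ∧
      Theorems.GapDecaySuffices.Negative.Relabel.DistinctLabels d' ∧
      ∃ e : d'.N = d.N, ∀ i : Fin d'.N,
        d'.motion i = ((d.motion (Fin.cast e i)).1 * Q (Fin.cast e i), (d.motion (Fin.cast e i)).2) ∧
        d'.excision i = d.excision (Fin.cast e i) ∧
        ∀ pr : ℝ → ℝ → ℝ → Prop,
          d'.chart i '' {x | pr ((d'.background i).time x.1) ((d'.background i).radius x.1) (x.1 0)} =
            d.chart (Fin.cast e i) '' {x | pr ((d.background (Fin.cast e i)).time x.1)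
              ((d.background (Fin.cast e i)).radius x.1) (x.1 0)} :=
  Theorems.GapDecaySuffices.Relabel.stub_parityRelabelDecomposition d R₀ Q hQQ hQ0 hQu hQ3 hc hdv

/-! ## The composition -/

set_option maxHeartbeats 800000 in
/-- **The line closes the crux modulo its stubs** (v7): `GapDecaySuffices` from S1–S5 and the two parity-safe
downstream variants.  Pure logic: for a hole-free input the landed unconditional
`…ReductionZero.necksCertify_of_N_eq_zero`; otherwise the relabelled certificate of S5 (fed by S1 applied to
the `NeckGapDecay` hypothesis), cone separation (landed CS) for the relabelled input, chart surgery (core form)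
and the seam (`0 < N`, `Hf`(2)-only form) for the relabelled input, whose charted region — hence exterior — is
that of the input. -/
theorem GapDecaySuffices_of (h₁ : Theses.StarvedNecks.NeckGapDecay → GapBootstrap)
    (h₂ : FlatFarCertified) (h₃ : SwitchOffInward) (h₄ : AnchoredLocationP)
    (h₆ : LabelMatching)
    (h₅ : GapBootstrap → FlatFarCertified → SwitchOffInward → AnchoredLocationP → LabelMatching →
      WeakCertificateAfterRelabelling)
    (h₇ : ChartSurgeryCore) (h₈ : SeamSurgeryPos) :
    Theses.StarvedNecks.GapDecaySuffices := by
  intro hGap X _ _ _ _ D hD 𝒟 h𝒟 O d R₀ hO hc hf hdv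
  rcases Nat.eq_zero_or_pos d.N with hN | hN
  · exact Theorems.NecksCertifyTwoCap.ReductionZero.necksCertify_of_N_eq_zero X D hD 𝒟 h𝒟 O d R₀ hO
      hc hf hN
  have hB : GapBootstrap := h₁ hGap
  obtain ⟨d', R₀', hch, hN', hc', hf2', hdv', hcert⟩ :=
    h₅ hB h₂ h₃ h₄ h₆ X D hD 𝒟 h𝒟 O d R₀ hO hc hf hdv (hB X D hD 𝒟 h𝒟 O d R₀ hO hc hf hdv) hN
  have hO' : O = exteriorOf 𝒟.toCauchyDevelopment d'.charted := by rw [hch]; exact hO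
  obtain ⟨c, hc0, τc, hcone⟩ :=
    Theorems.NecksCertifyTwoCap.Cones.stub_coneSeparation _ O 4 d' (fun i ↦ (hc'.1 i).2.2) hdv'
  have hatlas : NeckAtlas 𝒟.toSpacetime O d' R₀' := h₇ X D hD 𝒟 h𝒟 O d' R₀' hO' hc' hcert ⟨c, hc0, τc, hcone⟩
  exact h₈ X D hD 𝒟 h𝒟 O d' R₀' hO' hc' hf2' hN' hatlas

/-- The crux by name, from the registered stubs. -/
theorem gapDecaySuffices : Theses.StarvedNecks.GapDecaySuffices :=
  GapDecaySuffices_of stub_gapBootstrap stub_flatFarCertified stub_switchOffInward stub_anchoredLocation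
    stub_labelMatching stub_assembly stub_chartSurgeryCore stub_seamSurgeryPos

end Summit.FinalStateConjecture.FinalStateConjecture.Cruxes.GapDecaySuffices.Sketch

end
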